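import Literature.Geometry.Hyperkaehler.KaehlerFormSquareNotInvariant
import Literature.AlgebraicGeometry.Motives.HermitianUnitaryFrame
import HarnessLib

/-!
# A real `2`-form is invariant under a complex structure anticommuting with `I` iff its Hermitian form has balanced
# signature `(k, k, n₀)` (Buskin–Izadi, the twistor-line component of `Compl_Ω`, pointwise, both directions)

Topic `Literature/Geometry/Hyperkaehler`, namespace `Literature.Geometry.Hyperkaehler`. Written by the literature seat
`lit-w-verbitsky` (gen 7) of the cell `pub-hsemireg` (HodgeConjecture venture), 2026-08-24. Companion of
`KaehlerFormSquareNotInvariant.lean` §6 (the DEFINITE case: no `I`-positive real `2`-form is `ad J`-trivial, the pointwise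
form of "no twistor line passes through a Kähler class", [BI20] Cor. 5.5); here is the INDEFINITE case as printed by
Buskin–Izadi in the proof of their Theorem 5.4: if a real `2`-form `Ω` on `V_ℝ` is invariant under two anticommuting
complex-structure operators `I`, `J`, then the Hermitian form `h` associated to `Ω` and `I` changes sign under `J`, so
its signature `(n₊, n₋, n₀)` has `n₊ = n₋` (and `n₀ = 2n − 2n₊` is even). This is the linear algebra behind the printed
statements "the twistor-line component of `Compl_Ω` is `Sign⁻¹(n − n₀/2, n − n₀/2, n₀)`" (Thm. 5.4) and "the hermitian
form associated to the first Chern class [of a bundle extending to the twistor family] has signature of the form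
`(n − n₀/2, n − n₀/2, n₀)`" (Cor. 3) — rows V-V20 / V-V21 of the cell's table of Verbitsky-side printed statements.

## Source, verbatim (N. Buskin, E. Izadi, *Twistor lines in the period domain of complex tori*, Geom. Dedicata 213
(2021) 21–47 = arXiv:1806.07831**v2**; `p.N L.m` = page/line of the arXiv v2 PDF held by the cell, journal pages unseen)

* §5, p.23 L20–33: "Let `I` be a complex structure operator in `Compl_Ω`, that is, `Ω(Iu, Iv) = Ω(u, v)` for all
  `u, v ∈ V_ℝ`. On the vector space `(V_ℝ, I)`, considered as a complex vector space, the form `Ω` determines a hermitian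
  form `h(u, v) := Ω(u, Iv) − iΩ(u, v)` […] which we will call the hermitian form associated to `Ω` and `I`. The signature
  of `h` is a triple `(n₊, n₋, n₀)`, where `n₊`, `n₋` and `n₀` are the complex dimensions of, respectively, a maximal
  positive subspace `V₊`, a maximal negative subspace `V₋`, and the null subspace
  `V₀ = {u ∈ V_ℝ | h(u, v) = 0 for all v ∈ V_ℝ} = {u ∈ V_ℝ | Ω(u, v) = 0 for all v ∈ V_ℝ}` of `h` in `(V_ℝ, I)`, so that
  `n₊ + n₋ + n₀ = 2n`."
* Thm. 5.4, p.24 L54–74: "[…] If `n₀` is even, there is precisely one connected component of `Compl^±_Ω` that contains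
  twistor lines. This component is `Sign⁻¹(n − n₀/2, n − n₀/2, n₀)` and is twistor path connected. If `n₀` is odd, there
  are no connected components of `Compl^±_Ω` containing a twistor line."
* Proof of Thm. 5.4, "The component containing a twistor line", p.26 L26–39: "We first note that `Compl_Ω` contains a
  twistor line `S = S(I, J)` if and only if `Ω` is both `I`- and `J`-invariant, that is, `I, J ∈ Compl_Ω`. Let us assume
  that `Ω` is invariant with respect to anticommuting complex structure operators `I` and `J`, that is
  `Ω(Iu, Iv) = Ω(Ju, Jv) = Ω(u, v)` for all `u, v ∈ V_ℝ`. Then for all `u, v ∈ V_ℝ` the form `h` associated to `Ω` and `I`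
  satisfies `h(Ju, Jv) = Ω(Ju, IJv) − iΩ(Ju, Jv) = −Ω(Ju, JIv) − iΩ(Ju, Jv) = −Ω(u, Iv) − iΩ(u, v) = −h(u, v)`. This
  implies that the hermitian forms `h(u, v)` and `−h(u, v)` are equivalent under `J`, therefore they must have the same
  signature, so that the signature `(n₊, n₋, n₀)` of `h(u, v)` and the signature `(n₋, n₊, n₀)` of `−h(u, v)` are equal,
  that is, `n₊ = n₋`. It also follows that `n₀` is even."
* Cor. 3, p.3 L23–32: "Let `M` be a hyperkähler manifold and `ω = g(I·, ·)` a Kähler class on `M` associated to a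
  complex structure `I` of the twistor family. If an `ω`-slope-polystable bundle over `M` extends to the twistor family
  `𝓜`, then, either its first Chern class is zero, or the hermitian form associated to its first Chern class has
  signature of the form `(n − n₀/2, n − n₀/2, n₀)`."

## What is formalised (theorems only; no definition, no named fact, no `sorry`)

`E` is a complex normed space (its scalar multiplication by `i` is the operator `I`), `J : E →L[ℝ] E` a real-linear
operator with `J(Iv) = −I(Jv)` (and `J² = −1` where needed), `Ω : E [⋀^Fin 2]→L[ℝ] ℝ` a real `2`-covector with
`Ω(Ju, Jv) = Ω(u, v)` (equivalently `ad J Ω = 0`, the tree's `IsLinearHyperkaehler.adAlt_eq_zero_iff_apply₂_invariant`).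
The real quadratic form of `h` is `u ↦ h(u, u) = Ω(u, Iu)`; "positive / negative subspace" below means a real subspace
on whose non-zero vectors `Ω(u, Iu) > 0` / `< 0` (for an `I`-STABLE real subspace = a complex subspace of `(V_ℝ, I)` this
is the printed notion, and `I`-stability is preserved, §3).

* §1 `apply₂_J_I_J_eq_neg` — the printed computation `Ω(Ju, IJv) = −Ω(u, Iv)` (real part of `h(Ju, Jv) = −h(u, v)`),
  `hermitianForm_J_J_eq_neg` — the full identity for `h(u, v) = Ω(u, Iv) − iΩ(u, v) ∈ ℂ`, which reads EXACTLY
  `h(Ju, Jv) = −conj(h(u, v))` (`J` is conjugate-linear; the printed "`= −h(u, v)`" is this up to conjugation and is exact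
  on the diagonal), `apply₂_J_I_J_self_eq_neg` — `h(Ju, Ju) = −h(u, u)`, the case that governs signatures, and
  `apply₂_I_symm` / `hermitianForm_conj_symm` — for an `I`-invariant `Ω` the form `h` is hermitian.
* §2 `neg_on_map_J_of_pos_on` / `pos_on_map_J_of_neg_on` — `J` carries positive subspaces to negative ones and back;
  (private) `finrank_map_J_eq` — `dim J(P) = dim P` (`J` is invertible, `J⁻¹ = −J`).
* §3 `I_smul_mem_map_J` — `J` carries `I`-stable real subspaces (complex subspaces) to `I`-stable ones.
* §4 **`finrank_pos_eq_finrank_neg_of_maximal`** — if `P` is a positive subspace of maximal dimension and `N` a negative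
  subspace of maximal dimension then `dim P = dim N` ("`n₊ = n₋`", stated with the maximality as hypotheses, so that no
  signature function has to be defined; by Sylvester's law these maxima are the inertia indices), in the real and in the
  `I`-stable (complex-subspace) reading; `finrank_pos_le_finrank_neg_of_maximal` / `…neg_le…pos…` are the two halves.
* §5 `even_nullity_of_balanced` — the printed afterthought "`n₀` is even": from `n₊ + n₋ + n₀ = 2n` (even total complex
  dimension, e.g. `IsLinearHyperkaehler.even_finrank`) and `n₊ = n₋` (arithmetic, recorded for completeness), and
  `J_mem_nullSpace` — the null space `{u | Ω(u, ·) = 0}` is `J`-stable (and `I`-stable), the structural reason.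
* §6 at the level of Verbitsky's `ad`: the same statements from `ad J Ω = 0` (`…_of_adAlt_eq_zero`), and for a linear
  hyperkähler structure `(g₀, I, J)` from `SU(2)`-invariance of `Ω` (`IsLinearHyperkaehler.…_of_forall_quaternion_invariant`);
  `not_J_invariant_of_pos` — the definite corner (no `J` at all when `Ω` is `I`-positive; [BI20] Cor. 5.5 pointwise).
* §7 THE CONVERSE CONSTRUCTION, as printed (p.26 L40–p.27 L7): given a complex frame `b` indexed by `ι ⊕ ι` that is
  `h`-orthogonal with `h(b_{inl j}, b_{inl j}) = η_j = −h(b_{inr j}, b_{inr j})` (Buskin–Izadi's `u_i`, `v_i` and the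
  paired basis `w_{2s−1}, w_{2s}` of `V₀`), the tree's quaternionic structure `J_b = quaternionicOfBasis b` (Joyce's `J₂`
  in the frame: `J_b b_{inl j} = b_{inr j}`, `J_b b_{inr j} = −b_{inl j}`, conjugate-linear — verbatim their `J`) leaves
  `Ω` invariant: `apply₂_eq_sum_coord` (`Ω = Σ_k η_k Im(z̄_k w_k)` in the frame), **`apply₂_quaternionicOfBasis`**
  (`Ω(J_b u, J_b v) = Ω(u, v)`), `exists_isLinearHyperkaehler_quaternionicOfBasis` (a hyperkähler metric for `J_b`,
  Joyce's flat model), **`exists_isLinearHyperkaehler_invariant_of_adapted_basis`** and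
  `exists_isLinearHyperkaehler_forall_quaternion_invariant_of_adapted_basis` (∃ `(g₀, J)` linear hyperkähler with
  `Ω(J·, J·) = Ω`, `ad J Ω = 0`, indeed `Ω` fixed by the whole `SU(2)` — "the twistor line `S(I, J)` lies in `Compl_Ω`").
* §8 SYLVESTER'S STEP (the `h`-orthogonal decomposition the printed proof starts from): `exists_sesqForm` (the hermitian
  form of `Ω` as a sesquilinear map, existence form), `exists_orthogonal_frame` (an `h`-orthogonal complex frame with
  real diagonal `d_k`, from the tree's spectral-theorem basis `Motives.hermitianEigVecBasis`), `exists_normalised_frame`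
  (rescale to `d_k ∈ {1, −1, 0}`), `exists_adapted_frame` (re-index by `κ ⊕ κ` when `#{d > 0} = #{d < 0}` and `#{d = 0}` is
  even), and **`exists_isLinearHyperkaehler_invariant_of_card_pos_eq_card_neg`** (the converse from counting hypotheses).
* §9 INTRINSIC FORM: `apply₂_self_I_eq_sum` (`h(u, u) = Σ d_k |z_k|²`), `finrank_le_card_pos` /
  `exists_pos_submodule_finrank_eq_card` / `card_pos_eq_finrank_of_maximal` / `card_neg_eq_finrank_of_maximal` (Sylvester's
  law of inertia for `h`, degenerate forms allowed: the frame counts are the largest complex dimensions of positive /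
  negative complex subspaces), `exists_submodule_image_J` (`J` carries a complex subspace onto one of the same dimension),
  `finrank_pos_eq_finrank_neg_complex` ("`n₊ = n₋`" for complex subspaces), and the headline
  **`exists_anticommuting_invariant_iff_finrank_pos_eq_finrank_neg`**: for an `I`-invariant `Ω` on an even-dimensional
  complex space, a complex-structure operator `J` anticommuting with `I` and leaving `Ω` invariant EXISTS iff `n₊ = n₋`
  (`n₊`, `n₋` = dimensions of maximal positive / negative complex subspaces), and then `(I, J)` extends to a linear
  hyperkähler structure (`exists_isLinearHyperkaehler_invariant_of_finrank_pos_eq_finrank_neg`).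
* §10 THE PARITY CLAUSE OF THM. 5.4 ("if `n₀` is odd, there are no connected components of `Compl^±_Ω` containing a
  twistor line"): `exists_isLinearHyperkaehler_of_anticommuting` (every anticommuting pair `(I, J)` carries a linear
  hyperkähler metric — average an `I`-hermitian metric over `J`), `even_finrank_of_anticommuting` (hence `dim_ℂ E` is
  even), `exists_nullSpace_finrank_eq_card` (`V₀ = {u | Ω(u, ·) = 0}` has complex dimension `#{d = 0}` in any frame) and
  **`even_finrank_nullSpace_of_anticommuting_invariant`** (if some `J` anticommuting with `I` leaves `Ω` invariant, then
  `n₀ = dim_ℂ V₀` is even).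

SCOPE NOTES (faithfulness). (i) Pointwise / constant-form level only (for a compact complex torus `V_ℝ/Γ` the constant
`2`-forms ARE `H²`, which is the setting of [BI20] §5); nothing about bundles, slope-stability or the twistor family —
Cor. 3 combines this linear algebra with Verbitsky's extension theorem ([BI20] p.3 L44–49, `[9, Thm. 3.17, Thm. 3.19]`),
which is NOT in the tree. (ii) The CONVERSE half of the printed argument (p.26 L40–p.27 L7) is formalised in two layers: §7
constructs `J` FROM an adapted frame exactly as printed (`J = J_b`, Joyce's `J₂` in the frame), §8 produces the frame
(Sylvester: spectral theorem for the Gram matrix through the tree's `Motives.hermitianEigVecBasis`, rescaling, re-indexing),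
and §9 turns the counting hypotheses into the intrinsic `n₊ = n₋`; the EVEN complex dimension of `V_ℝ` ([BI20]:
`V_ℝ ≅ ℝ^{4n}`) is an explicit hypothesis of the intrinsic statements. The connectivity / counting statements of Thm. 5.4
("precisely one component", "twistor path connected", "`2n + 1 − n₀` components") are NOT formalised here; its parity
clause ("if `n₀` is odd … no twistor line") is §10. (iii) "Signature"
is not introduced as a function: `n₊`, `n₋` enter as the dimensions of positive / negative complex subspaces that are
maximal in dimension, which §9 identifies with the frame counts (Sylvester's law of inertia, degenerate case included;
cf. the tree's `Motives.SignatureSplitting` / `Motives.UnitaryFrame` for the non-degenerate bookkeeping). (iv) `[folklore]` marks plumbing no source prints in this form.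

## References

* [BuskinIzadi2020TwistorLinesTori] N. Buskin, E. Izadi, Geom. Dedicata 213 (2021) 21–47 = arXiv:1806.07831v2, §5
  (definition of the hermitian form associated to `Ω` and `I`, p.23), Thm. 5.4 (p.24) and its proof, "The component
  containing a twistor line" (p.26 L26–39); Cor. 3 (p.3) (read, arXiv v2 PDF; journal pages unseen).
* [Verbitsky1996Hyperholomorphic] M. Verbitsky, J. Alg. Geom. 5 (1996) 633–669 = alg-geom/9307008, §1 (definition of
  `ad`, Prop. 1.2: `G_M`-invariant ⟺ of type `(p,p)` for every induced complex structure).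
* [GohbergLancasterRodman2005] I. Gohberg, P. Lancaster, L. Rodman, *Indefinite Linear Algebra and Applications* (2005),
  §2.3 Thm. 2.3.2 (inertia indices as maximal dimensions of definite subspaces), (2.3.8) and Thm. A.1.1 (diagonalising
  the Gram matrix; the tree's `Motives/HermitianUnitaryFrame.lean`).
* [Joyce2007] D. Joyce, *Riemannian Holonomy Groups and Calibrated Geometry* (2007), §10.1.1 eq. (10.1) (the flat model
  `(g, J₁, J₂, J₃)` on `ℍ^m = ℂ^{2m}`; the tree's `quaternionicOfBasis`, `isLinearHyperkaehler_quaternionicOfBasis`).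
-/

noncomputable section

open Complex Function Module Literature.LinearAlgebra.Alternating
open scoped ComplexConjugate

namespace Literature.Geometry.Hyperkaehler

variable {E : Type*} [NormedAddCommGroup E] [NormedSpace ℂ E] {J : E →L[ℝ] E}

/-! ## §1 `h(Ju, Jv) = −h(u, v)` ([BI20] p.26 L29–35) -/

/-- **`Ω(Ju, I Jv) = −Ω(u, Iv)`** for a `J` anticommuting with `I` and a `J`-invariant `2`-covector `Ω`: the real part of
the printed identity `h(Ju, Jv) = Ω(Ju, IJv) − iΩ(Ju, Jv) = −Ω(Ju, JIv) − iΩ(Ju, Jv) = −Ω(u, Iv) − iΩ(u, v) = −h(u, v)`.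
[cite: BuskinIzadi2020TwistorLinesTori, §5 proof of Thm. 5.4, "The component containing a twistor line" (arXiv v2 p.26 L29–35)] -/
theorem apply₂_J_I_J_eq_neg (hJI : ∀ v : E, J (I • v) = -(I • J v)) {Ω : E [⋀^Fin 2]→L[ℝ] ℝ}
    (hΩJ : ∀ u v : E, Ω ![J u, J v] = Ω ![u, v]) (u v : E) :
    Ω ![J u, I • J v] = -Ω ![u, I • v] := by
  have hIJ : I • J v = -J (I • v) := by rw [hJI, neg_neg]
  rw [hIJ, apply₂_neg_right, hΩJ]

/-- **`h(Ju, Jv) = −h̄(u, v)`** for the Hermitian form `h(u, v) = Ω(u, Iv) − iΩ(u, v)` associated to `Ω` and `I`, when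
`Ω` is invariant under a `J` anticommuting with `I`: `J` pulls `h` back to MINUS ITS CONJUGATE ("the hermitian forms
`h(u, v)` and `−h(u, v)` are equivalent under `J`" — `J` being conjugate-linear, an equivalence of hermitian forms under
`J` carries this conjugation; the printed chain p.26 L32–35 ends "`= −Ω(u, Iv) − iΩ(u, v) = −h(u, v)`", whose last
step holds up to complex conjugation and exactly on the diagonal `u = v`, the only case entering signatures —
`apply₂_J_I_J_self_eq_neg`). [cite: BuskinIzadi2020TwistorLinesTori, §5 (definition of h, arXiv v2 p.23 L20–25) and proof of Thm. 5.4 (p.26 L29–36)] -/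
theorem hermitianForm_J_J_eq_neg (hJI : ∀ v : E, J (I • v) = -(I • J v)) {Ω : E [⋀^Fin 2]→L[ℝ] ℝ}
    (hΩJ : ∀ u v : E, Ω ![J u, J v] = Ω ![u, v]) (u v : E) :
    ((Ω ![J u, I • J v] : ℝ) : ℂ) - I * ((Ω ![J u, J v] : ℝ) : ℂ) =
      -(starRingEnd ℂ (((Ω ![u, I • v] : ℝ) : ℂ) - I * ((Ω ![u, v] : ℝ) : ℂ))) := by
  rw [apply₂_J_I_J_eq_neg hJI hΩJ, hΩJ, Complex.ofReal_neg, map_sub, map_mul, Complex.conj_ofReal,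
    Complex.conj_ofReal, Complex.conj_I]
  ring

/-- **`h(Ju, Ju) = −h(u, u)`**: the real quadratic form `u ↦ Ω(u, Iu)` of `h` changes sign under `J`.
[cite: BuskinIzadi2020TwistorLinesTori, §5 proof of Thm. 5.4 (arXiv v2 p.26 L29–36)] -/
theorem apply₂_J_I_J_self_eq_neg (hJI : ∀ v : E, J (I • v) = -(I • J v)) {Ω : E [⋀^Fin 2]→L[ℝ] ℝ}
    (hΩJ : ∀ u v : E, Ω ![J u, J v] = Ω ![u, v]) (u : E) :
    Ω ![J u, I • J u] = -Ω ![u, I • u] :=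
  apply₂_J_I_J_eq_neg hJI hΩJ u u

/-- `h` IS hermitian: for an `I`-invariant `Ω` the real part `Ω(u, Iv)` is symmetric in `u, v` ("note that
`h(u, Iv) = −ih(u, v)`, `h(Iu, v) = ih(u, v)`"; here the symmetry `Ω(v, Iu) = Ω(u, Iv)`, from `Ω(Iu, I·Iv) = Ω(u, Iv)`).
[cite: BuskinIzadi2020TwistorLinesTori, §5 (arXiv v2 p.23 L20–25)] -/
theorem apply₂_I_symm {Ω : E [⋀^Fin 2]→L[ℝ] ℝ} (hΩI : ∀ u v : E, Ω ![I • u, I • v] = Ω ![u, v]) (u v : E) :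
    Ω ![v, I • u] = Ω ![u, I • v] := by
  have e : Ω ![I • u, I • (I • v)] = Ω ![u, I • v] := hΩI u (I • v)
  rw [smul_smul, Complex.I_mul_I, neg_one_smul, apply₂_neg_right] at e
  rw [← e, apply₂_swap Ω v (I • u), neg_neg]

/-- `h(v, u) = conj(h(u, v))` for an `I`-invariant `Ω`: the form associated to `Ω` and `I` is hermitian.
[cite: BuskinIzadi2020TwistorLinesTori, §5 (arXiv v2 p.23 L20–25: "the form Ω determines a hermitian form h(u, v) := Ω(u, Iv) − iΩ(u, v)")] -/
theorem hermitianForm_conj_symm {Ω : E [⋀^Fin 2]→L[ℝ] ℝ} (hΩI : ∀ u v : E, Ω ![I • u, I • v] = Ω ![u, v]) (u v : E) :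
    ((Ω ![v, I • u] : ℝ) : ℂ) - I * ((Ω ![v, u] : ℝ) : ℂ) =
      starRingEnd ℂ (((Ω ![u, I • v] : ℝ) : ℂ) - I * ((Ω ![u, v] : ℝ) : ℂ)) := by
  rw [apply₂_I_symm hΩI, apply₂_swap Ω u v, Complex.ofReal_neg, map_sub, map_mul, Complex.conj_ofReal,
    Complex.conj_ofReal, Complex.conj_I]
  ring

/-! ## §2 `J` exchanges positive and negative subspaces of `h` and preserves dimension -/

/-- **`J` maps a positive subspace of `h` onto a negative one**: if `Ω(v, Iv) > 0` for every non-zero `v ∈ P` then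
`Ω(w, Iw) < 0` for every non-zero `w ∈ J(P)`. [cite: BuskinIzadi2020TwistorLinesTori, §5 proof of Thm. 5.4 (arXiv v2 p.26 L36–38: "equivalent under J, therefore they must have the same signature")] -/
theorem neg_on_map_J_of_pos_on (hJI : ∀ v : E, J (I • v) = -(I • J v)) {Ω : E [⋀^Fin 2]→L[ℝ] ℝ}
    (hΩJ : ∀ u v : E, Ω ![J u, J v] = Ω ![u, v]) {P : Submodule ℝ E}
    (hP : ∀ v ∈ P, v ≠ 0 → 0 < Ω ![v, I • v]) :
    ∀ w ∈ P.map (J : E →ₗ[ℝ] E), w ≠ 0 → Ω ![w, I • w] < 0 := by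
  rintro w ⟨v, hv, rfl⟩ hw
  have hv0 : v ≠ 0 := by
    rintro rfl
    exact hw (map_zero _)
  rw [ContinuousLinearMap.coe_coe, apply₂_J_I_J_self_eq_neg hJI hΩJ, neg_lt_zero]
  exact hP v hv hv0

/-- **`J` maps a negative subspace of `h` onto a positive one.**
[cite: BuskinIzadi2020TwistorLinesTori, §5 proof of Thm. 5.4 (arXiv v2 p.26 L36–38)] -/
theorem pos_on_map_J_of_neg_on (hJI : ∀ v : E, J (I • v) = -(I • J v)) {Ω : E [⋀^Fin 2]→L[ℝ] ℝ}
    (hΩJ : ∀ u v : E, Ω ![J u, J v] = Ω ![u, v]) {N : Submodule ℝ E}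
    (hN : ∀ v ∈ N, v ≠ 0 → Ω ![v, I • v] < 0) :
    ∀ w ∈ N.map (J : E →ₗ[ℝ] E), w ≠ 0 → 0 < Ω ![w, I • w] := by
  rintro w ⟨v, hv, rfl⟩ hw
  have hv0 : v ≠ 0 := by
    rintro rfl
    exact hw (map_zero _)
  rw [ContinuousLinearMap.coe_coe, apply₂_J_I_J_self_eq_neg hJI hΩJ, neg_pos]
  exact hN v hv hv0

/-- **`dim J(P) = dim P`**: `J` with `J² = −1` is invertible (`J⁻¹ = −J`); private plumbing. [folklore] -/
private theorem finrank_map_J_eq (hJJ : ∀ v : E, J (J v) = -v) (P : Submodule ℝ E) :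
    finrank ℝ (P.map (J : E →ₗ[ℝ] E)) = finrank ℝ P := by
  let e : E ≃ₗ[ℝ] E :=
    LinearEquiv.ofLinear (J : E →ₗ[ℝ] E) (-(J : E →ₗ[ℝ] E))
      (by ext v; simp [hJJ]) (by ext v; simp [hJJ])
  have he : (e : E →ₗ[ℝ] E) = (J : E →ₗ[ℝ] E) := rfl
  rw [← he]
  exact e.finrank_map_eq P

/-! ## §3 Complex subspaces go to complex subspaces -/

/-- **`J` carries `I`-stable real subspaces (= complex subspaces of `(V_ℝ, I)`) to `I`-stable ones**, since `I(Jv) = −J(Iv)`: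
the printed `V₊`, `V₋` are complex subspaces and so are their `J`-images. [cite: BuskinIzadi2020TwistorLinesTori, §5 (arXiv v2 p.23 L26–30; p.26 L42–44 "which are complex subspaces of (V_ℝ, I)")] -/
theorem I_smul_mem_map_J (hJI : ∀ v : E, J (I • v) = -(I • J v)) {P : Submodule ℝ E}
    (hPI : ∀ v ∈ P, I • v ∈ P) {w : E} (hw : w ∈ P.map (J : E →ₗ[ℝ] E)) :
    I • w ∈ P.map (J : E →ₗ[ℝ] E) := by
  obtain ⟨v, hv, rfl⟩ := hw
  refine ⟨-(I • v), P.neg_mem (hPI v hv), ?_⟩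
  simp only [ContinuousLinearMap.coe_coe, map_neg, hJI, neg_neg]

/-! ## §4 `n₊ = n₋` ([BI20] p.26 L36–38) -/

/-- **`n₊ ≤ n₋`, real reading**: a positive subspace has dimension at most that of any negative subspace of maximal
dimension (its `J`-image is negative of the same dimension). [cite: BuskinIzadi2020TwistorLinesTori, §5 proof of Thm. 5.4 (arXiv v2 p.26 L36–38)] -/
theorem finrank_pos_le_finrank_neg_of_maximal (hJJ : ∀ v : E, J (J v) = -v)
    (hJI : ∀ v : E, J (I • v) = -(I • J v)) {Ω : E [⋀^Fin 2]→L[ℝ] ℝ} (hΩJ : ∀ u v : E, Ω ![J u, J v] = Ω ![u, v])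
    {P N : Submodule ℝ E} (hP : ∀ v ∈ P, v ≠ 0 → 0 < Ω ![v, I • v])
    (hNmax : ∀ Q : Submodule ℝ E, (∀ v ∈ Q, v ≠ 0 → Ω ![v, I • v] < 0) → finrank ℝ Q ≤ finrank ℝ N) :
    finrank ℝ P ≤ finrank ℝ N := by
  have h := hNmax _ (neg_on_map_J_of_pos_on hJI hΩJ hP)
  rwa [finrank_map_J_eq hJJ] at h

/-- **`n₋ ≤ n₊`, real reading.** [cite: BuskinIzadi2020TwistorLinesTori, §5 proof of Thm. 5.4 (arXiv v2 p.26 L36–38)] -/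
theorem finrank_neg_le_finrank_pos_of_maximal (hJJ : ∀ v : E, J (J v) = -v)
    (hJI : ∀ v : E, J (I • v) = -(I • J v)) {Ω : E [⋀^Fin 2]→L[ℝ] ℝ} (hΩJ : ∀ u v : E, Ω ![J u, J v] = Ω ![u, v])
    {P N : Submodule ℝ E} (hN : ∀ v ∈ N, v ≠ 0 → Ω ![v, I • v] < 0)
    (hPmax : ∀ Q : Submodule ℝ E, (∀ v ∈ Q, v ≠ 0 → 0 < Ω ![v, I • v]) → finrank ℝ Q ≤ finrank ℝ P) :
    finrank ℝ N ≤ finrank ℝ P := by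
  have h := hPmax _ (pos_on_map_J_of_neg_on hJI hΩJ hN)
  rwa [finrank_map_J_eq hJJ] at h

/-- **`n₊ = n₋` (real reading).** If `Ω` is invariant under a complex-structure operator `J` anticommuting with `I`,
a positive subspace of `h` of maximal dimension and a negative subspace of maximal dimension have the same dimension:
"the hermitian forms `h(u, v)` and `−h(u, v)` are equivalent under `J`, therefore they must have the same signature, so
that […] `n₊ = n₋`". [cite: BuskinIzadi2020TwistorLinesTori, §5 proof of Thm. 5.4 (arXiv v2 p.26 L29–38)] -/
theorem finrank_pos_eq_finrank_neg_of_maximal (hJJ : ∀ v : E, J (J v) = -v)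
    (hJI : ∀ v : E, J (I • v) = -(I • J v)) {Ω : E [⋀^Fin 2]→L[ℝ] ℝ} (hΩJ : ∀ u v : E, Ω ![J u, J v] = Ω ![u, v])
    {P N : Submodule ℝ E} (hP : ∀ v ∈ P, v ≠ 0 → 0 < Ω ![v, I • v])
    (hPmax : ∀ Q : Submodule ℝ E, (∀ v ∈ Q, v ≠ 0 → 0 < Ω ![v, I • v]) → finrank ℝ Q ≤ finrank ℝ P)
    (hN : ∀ v ∈ N, v ≠ 0 → Ω ![v, I • v] < 0)
    (hNmax : ∀ Q : Submodule ℝ E, (∀ v ∈ Q, v ≠ 0 → Ω ![v, I • v] < 0) → finrank ℝ Q ≤ finrank ℝ N) :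
    finrank ℝ P = finrank ℝ N :=
  le_antisymm (finrank_pos_le_finrank_neg_of_maximal hJJ hJI hΩJ hP hNmax)
    (finrank_neg_le_finrank_pos_of_maximal hJJ hJI hΩJ hN hPmax)

/-- **`n₊ = n₋`, the printed (complex-subspace) reading.** The same with positivity, negativity and maximality taken
among `I`-STABLE real subspaces (= complex subspaces of `(V_ℝ, I)`, whose complex dimension is half the real one):
`J` carries `I`-stable subspaces to `I`-stable ones (§3). [cite: BuskinIzadi2020TwistorLinesTori, §5 (arXiv v2 p.23 L26–30) and proof of Thm. 5.4 (p.26 L29–38)] -/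
theorem finrank_pos_eq_finrank_neg_of_maximal_I_stable (hJJ : ∀ v : E, J (J v) = -v)
    (hJI : ∀ v : E, J (I • v) = -(I • J v)) {Ω : E [⋀^Fin 2]→L[ℝ] ℝ} (hΩJ : ∀ u v : E, Ω ![J u, J v] = Ω ![u, v])
    {P N : Submodule ℝ E} (hPI : ∀ v ∈ P, I • v ∈ P) (hP : ∀ v ∈ P, v ≠ 0 → 0 < Ω ![v, I • v])
    (hPmax : ∀ Q : Submodule ℝ E, (∀ v ∈ Q, I • v ∈ Q) → (∀ v ∈ Q, v ≠ 0 → 0 < Ω ![v, I • v]) →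
      finrank ℝ Q ≤ finrank ℝ P)
    (hNI : ∀ v ∈ N, I • v ∈ N) (hN : ∀ v ∈ N, v ≠ 0 → Ω ![v, I • v] < 0)
    (hNmax : ∀ Q : Submodule ℝ E, (∀ v ∈ Q, I • v ∈ Q) → (∀ v ∈ Q, v ≠ 0 → Ω ![v, I • v] < 0) →
      finrank ℝ Q ≤ finrank ℝ N) :
    finrank ℝ P = finrank ℝ N := by
  apply le_antisymm
  · have h := hNmax _ (fun w hw ↦ I_smul_mem_map_J hJI hPI hw) (neg_on_map_J_of_pos_on hJI hΩJ hP)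
    rwa [finrank_map_J_eq hJJ] at h
  · have h := hPmax _ (fun w hw ↦ I_smul_mem_map_J hJI hNI hw) (pos_on_map_J_of_neg_on hJI hΩJ hN)
    rwa [finrank_map_J_eq hJJ] at h

/-! ## §5 The null space and "`n₀` is even" ([BI20] p.26 L38–39) -/

/-- The null space `V₀ = {u | Ω(u, v) = 0 ∀ v}` of `Ω` is `J`-stable for a `J`-invariant `Ω` with `J² = −1`
(`Ω(Ju, v) = Ω(J u, J(−Jv)) = Ω(u, −Jv) = 0`). [cite: BuskinIzadi2020TwistorLinesTori, §5 (arXiv v2 p.23 L28–33: "V₀ being invariant with respect to every complex structure operator in Compl_Ω")] -/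
theorem J_mem_nullSpace (hJJ : ∀ v : E, J (J v) = -v) {Ω : E [⋀^Fin 2]→L[ℝ] ℝ}
    (hΩJ : ∀ u v : E, Ω ![J u, J v] = Ω ![u, v]) {u : E} (hu : ∀ v : E, Ω ![u, v] = 0) (v : E) :
    Ω ![J u, v] = 0 := by
  have e : v = J (-(J v)) := by rw [map_neg, hJJ, neg_neg]
  rw [e, hΩJ, apply₂_neg_right, hu, neg_zero]

/-- The null space is `I`-stable for an `I`-invariant `Ω` (so it is a complex subspace of `(V_ℝ, I)`, and by
`J_mem_nullSpace` a quaternionic one). [cite: BuskinIzadi2020TwistorLinesTori, §5 (arXiv v2 p.23 L28–33)] -/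
theorem I_smul_mem_nullSpace {Ω : E [⋀^Fin 2]→L[ℝ] ℝ} (hΩI : ∀ u v : E, Ω ![I • u, I • v] = Ω ![u, v]) {u : E}
    (hu : ∀ v : E, Ω ![u, v] = 0) (v : E) : Ω ![I • u, v] = 0 := by
  have e : v = I • (-(I • v)) := by rw [smul_neg, smul_smul, Complex.I_mul_I, neg_one_smul, neg_neg]
  rw [e, hΩI, apply₂_neg_right, hu, neg_zero]

/-- **"It also follows that `n₀` is even"**: with `n₊ + n₋ + n₀ = 2n'` the (even) complex dimension of `V_ℝ` — even because
`V_ℝ` carries the anticommuting pair `(I, J)`, cf. `IsLinearHyperkaehler.even_finrank` — and `n₊ = n₋`, the nullity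
`n₀` is even (arithmetic, recorded for completeness). [cite: BuskinIzadi2020TwistorLinesTori, §5 proof of Thm. 5.4 (arXiv v2 p.26 L38–39 and p.26 L45–46 "since n₊ + n₋ + n₀ = 2k + l = 2n, l = n₀ is an even number")] -/
theorem even_nullity_of_balanced {npos nneg nnull d : ℕ} (hsum : npos + nneg + nnull = d) (hd : Even d)
    (hbal : npos = nneg) : Even nnull := by
  obtain ⟨m, hm⟩ := hd
  subst hbal
  exact ⟨m - npos, by omega⟩

/-! ## §6 The same from `ad J Ω = 0`, and from `SU(2)`-invariance for a linear hyperkähler structure -/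

/-- From Verbitsky's Lie-algebra condition: **`ad J Ω = 0` ⟹ `Ω(Ju, I Jv) = −Ω(u, Iv)`** (`ad J Ω = 0 ⟺ Ω(J·, J·) = Ω`
in degree `2`). [cite: BuskinIzadi2020TwistorLinesTori, §5 proof of Thm. 5.4 (arXiv v2 p.26 L29–35)] [cite: Verbitsky1996Hyperholomorphic, §1 Prop. 1.2] -/
theorem apply₂_J_I_J_eq_neg_of_adAlt_eq_zero (hJJ : ∀ v : E, J (J v) = -v)
    (hJI : ∀ v : E, J (I • v) = -(I • J v)) {Ω : E [⋀^Fin 2]→L[ℝ] ℝ} (hη : adAlt J Ω = 0) (u v : E) :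
    Ω ![J u, I • J v] = -Ω ![u, I • v] :=
  apply₂_J_I_J_eq_neg hJI ((IsLinearHyperkaehler.adAlt_eq_zero_iff_apply₂_invariant hJJ).mp hη) u v

/-- **`ad J Ω = 0` ⟹ `n₊ = n₋`** (real reading, maximality as hypotheses).
[cite: BuskinIzadi2020TwistorLinesTori, §5 proof of Thm. 5.4 (arXiv v2 p.26 L29–38)] [cite: Verbitsky1996Hyperholomorphic, §1 Prop. 1.2] -/
theorem finrank_pos_eq_finrank_neg_of_adAlt_eq_zero (hJJ : ∀ v : E, J (J v) = -v)
    (hJI : ∀ v : E, J (I • v) = -(I • J v)) {Ω : E [⋀^Fin 2]→L[ℝ] ℝ} (hη : adAlt J Ω = 0)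
    {P N : Submodule ℝ E} (hP : ∀ v ∈ P, v ≠ 0 → 0 < Ω ![v, I • v])
    (hPmax : ∀ Q : Submodule ℝ E, (∀ v ∈ Q, v ≠ 0 → 0 < Ω ![v, I • v]) → finrank ℝ Q ≤ finrank ℝ P)
    (hN : ∀ v ∈ N, v ≠ 0 → Ω ![v, I • v] < 0)
    (hNmax : ∀ Q : Submodule ℝ E, (∀ v ∈ Q, v ≠ 0 → Ω ![v, I • v] < 0) → finrank ℝ Q ≤ finrank ℝ N) :
    finrank ℝ P = finrank ℝ N :=
  finrank_pos_eq_finrank_neg_of_maximal hJJ hJI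
    ((IsLinearHyperkaehler.adAlt_eq_zero_iff_apply₂_invariant hJJ).mp hη) hP hPmax hN hNmax

/-- **Group level.** On the carrier of a linear hyperkähler structure `(g₀, I, J, K)`: if a real `2`-covector `Ω` is
invariant under every unit quaternion `a + bI + cJ + dK` (Verbitsky's isotropy group `G_M = SU(2)`; for the constant
`2`-forms = `H²` of a flat complex torus this is "`[Ω]` stays of type `(1,1)` along the twistor line", i.e. the twistor
line `S(I, J)` lies in `Compl_Ω`), then the Hermitian form of `Ω` has `n₊ = n₋` (real reading, maximality as hypotheses) —
the pointwise content of "the component containing twistor lines is `Sign⁻¹(n − n₀/2, n − n₀/2, n₀)`" and of Cor. 3's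
signature constraint on `c₁`. [cite: BuskinIzadi2020TwistorLinesTori, Thm. 5.4 and its proof (arXiv v2 p.24 L64–74, p.26 L26–39); Cor. 3 (p.3 L23–32)] [cite: Verbitsky1996Hyperholomorphic, §1 Prop. 1.1 and Prop. 1.2] -/
theorem IsLinearHyperkaehler.finrank_pos_eq_finrank_neg_of_forall_quaternion_invariant {g₀ : E →L[ℝ] E →L[ℝ] ℝ}
    (hk : IsLinearHyperkaehler g₀ J) {Ω : E [⋀^Fin 2]→L[ℝ] ℝ}
    (hq : ∀ a b c d : ℝ, a ^ 2 + b ^ 2 + c ^ 2 + d ^ 2 = 1 →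
      Ω.compContinuousLinearMap (a • ContinuousLinearMap.id ℝ E + b • opI E + c • J + d • opK J) = Ω)
    {P N : Submodule ℝ E} (hP : ∀ v ∈ P, v ≠ 0 → 0 < Ω ![v, I • v])
    (hPmax : ∀ Q : Submodule ℝ E, (∀ v ∈ Q, v ≠ 0 → 0 < Ω ![v, I • v]) → finrank ℝ Q ≤ finrank ℝ P)
    (hN : ∀ v ∈ N, v ≠ 0 → Ω ![v, I • v] < 0)
    (hNmax : ∀ Q : Submodule ℝ E, (∀ v ∈ Q, v ≠ 0 → Ω ![v, I • v] < 0) → finrank ℝ Q ≤ finrank ℝ N) :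
    finrank ℝ P = finrank ℝ N :=
  finrank_pos_eq_finrank_neg_of_adAlt_eq_zero hk.J_J hk.J_I (hk.forall_compContinuousLinearMap_quaternion_iff.mp hq).2
    hP hPmax hN hNmax

/-- **Definite corner** (consistency with `KaehlerFormSquareNotInvariant` §6 / [BI20] Cor. 5.5): if `Ω` is `I`-POSITIVE
(`Ω(v, Iv) > 0` for all `v ≠ 0`, a Kähler class) on a non-zero space, no negative subspace is non-zero while `⊤` is
positive, so `n₊ = n₋` fails — hence no `J` anticommuting with `I` leaves `Ω` invariant ("no twistor lines passing
through `I` in `Compl_Ω`"). [cite: BuskinIzadi2020TwistorLinesTori, Cor. 5.5 (arXiv v2 p.24 L76–77; proof p.25 L5–9: "its signature is of the form (2n, 0, 0)")] -/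
theorem not_J_invariant_of_pos [Nontrivial E] (hJJ : ∀ v : E, J (J v) = -v)
    (hJI : ∀ v : E, J (I • v) = -(I • J v)) {Ω : E [⋀^Fin 2]→L[ℝ] ℝ}
    (hpos : ∀ v : E, v ≠ 0 → 0 < Ω ![v, I • v]) : ¬ ∀ u v : E, Ω ![J u, J v] = Ω ![u, v] := by
  intro hΩJ
  obtain ⟨v, hv⟩ := exists_ne (0 : E)
  have hJv : J v ≠ 0 := fun hz ↦ hv (by simpa [hz] using (hJJ v).symm)
  have h1 := hpos (J v) hJv
  rw [apply₂_J_I_J_self_eq_neg hJI hΩJ, neg_pos] at h1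
  exact lt_irrefl _ (h1.trans (hpos v hv))

/-! ## §7 The converse construction ([BI20] p.26 L40–p.27 L7): from an `h`-adapted complex frame to a linear
hyperkähler structure `(g₀, I, J_b)` whose `J_b` leaves `Ω` invariant -/

section Converse

/-- `Ω` as a real bilinear map (private plumbing for coordinate sums). [folklore] -/
private theorem exists_bilin (Ω : E [⋀^Fin 2]→L[ℝ] ℝ) :
    ∃ L : E →ₗ[ℝ] E →ₗ[ℝ] ℝ, ∀ u v : E, Ω ![u, v] = L u v :=
  ⟨LinearMap.mk₂ ℝ (fun u v ↦ Ω ![u, v]) (apply₂_add_left Ω) (apply₂_smul_left Ω) (apply₂_add_right Ω)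
    (apply₂_smul_right Ω), fun _ _ ↦ rfl⟩

variable {κ : Type*} [Fintype κ] [DecidableEq κ]

omit [Fintype κ] in
/-- **`Ω` on an `h`-ORTHOGONAL complex frame, one pair of coordinates**: if `h(b_k, b_l) = η_k δ_{kl}` (i.e.
`Ω(b_k, I b_l) = η_k δ_{kl}`, `Ω(b_k, b_l) = 0`) for an `I`-invariant `Ω`, then
`Ω(z b_k, w b_l) = δ_{kl} η_k (Re z · Im w − Im z · Re w) = δ_{kl} η_k Im(z̄ w)`.
[cite: BuskinIzadi2020TwistorLinesTori, §5 proof of Thm. 5.4 (arXiv v2 p.26 L47–48: "h-orthonormal and, respectively, −h-orthonormal bases")] -/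
theorem apply₂_smul_basis {Ω : E [⋀^Fin 2]→L[ℝ] ℝ} (hΩI : ∀ u v : E, Ω ![I • u, I • v] = Ω ![u, v])
    (b : Module.Basis κ ℂ E) {η : κ → ℝ} (hb₁ : ∀ k l, Ω ![b k, I • b l] = if k = l then η k else 0)
    (hb₂ : ∀ k l, Ω ![b k, b l] = 0) (z w : ℂ) (k l : κ) :
    Ω ![z • b k, w • b l] = if k = l then η k * (z.re * w.im - z.im * w.re) else 0 := by
  have h3 : Ω ![I • b k, b l] = -(if k = l then η k else 0) := by
    rw [apply₂_swap Ω (b l) (I • b k), hb₁ l k]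
    by_cases hkl : k = l
    · subst hkl; simp
    · simp [hkl, Ne.symm hkl]
  have h4 : Ω ![I • b k, I • b l] = 0 := by rw [hΩI, hb₂]
  rw [Literature.NumberTheory.Transcendental.smul_eq_re_smul_add_im_smul z,
    Literature.NumberTheory.Transcendental.smul_eq_re_smul_add_im_smul w]
  simp only [apply₂_add_left, apply₂_add_right, apply₂_smul_left, apply₂_smul_right, smul_eq_mul, hb₁, hb₂, h3,
    h4]
  split_ifs <;> ring

/-- **`Ω` in the coordinates of an `h`-orthogonal complex frame**: `Ω(u, v) = Σ_k η_k Im(z̄_k(u) z_k(v))`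
(`= Σ_k η_k (Re z_k(u) Im z_k(v) − Im z_k(u) Re z_k(v))`), the real `2`-form whose hermitian form is the diagonal
form `Σ_k η_k |z_k|²`. [cite: BuskinIzadi2020TwistorLinesTori, §5 (arXiv v2 p.23 L20–25; p.26 L42–48)] -/
theorem apply₂_eq_sum_coord {Ω : E [⋀^Fin 2]→L[ℝ] ℝ} (hΩI : ∀ u v : E, Ω ![I • u, I • v] = Ω ![u, v])
    (b : Module.Basis κ ℂ E) {η : κ → ℝ} (hb₁ : ∀ k l, Ω ![b k, I • b l] = if k = l then η k else 0)
    (hb₂ : ∀ k l, Ω ![b k, b l] = 0) (u v : E) :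
    Ω ![u, v] = ∑ k, η k * ((b.equivFun u k).re * (b.equivFun v k).im - (b.equivFun u k).im * (b.equivFun v k).re) := by
  obtain ⟨L, hL⟩ := exists_bilin Ω
  conv_lhs => rw [← b.sum_equivFun u, ← b.sum_equivFun v]
  simp only [hL, map_sum, LinearMap.sum_apply]
  simp only [← hL, apply₂_smul_basis hΩI b hb₁ hb₂, Finset.sum_ite_eq', Finset.mem_univ, if_true]

variable {ι : Type*} [Fintype ι] [DecidableEq ι] [FiniteDimensional ℂ E]

/-- **Joyce's `J_b` preserves `Ω` when the frame is adapted**: for a complex frame `b` indexed by `ι ⊕ ι`,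
`h`-orthogonal for the `I`-invariant `Ω` with `h(b_{inl j}, b_{inl j}) = η_j = −h(b_{inr j}, b_{inr j})`, the
quaternionic structure `J_b` (`J_b b_{inl j} = b_{inr j}`, `J_b b_{inr j} = −b_{inl j}`, conjugate-linear) satisfies
`Ω(J_b u, J_b v) = Ω(u, v)` — Buskin–Izadi's `J(u_i) = v_i`, `J(Iu_i) = −Iv_i`, `J(v_i) = −u_i`, …,
`J(w_{2s−1}) = w_{2s}`, … (`η = 1` on the `u_i`, so `−1` on the `v_i`; `η = 0` on the null pairs): "Then `J`
anticommutes with `I` and one easily verifies that `J` takes `h` to `−h` […] so that `Ω(Ju, Jv) = Ω(u, v)`, that is,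
`Ω` is `J`-invariant." [cite: BuskinIzadi2020TwistorLinesTori, §5 proof of Thm. 5.4 (arXiv v2 p.26 L47–p.27 L7)] [cite: Joyce2007, §10.1.1 (J₂)] -/
theorem apply₂_quaternionicOfBasis {Ω : E [⋀^Fin 2]→L[ℝ] ℝ} (hΩI : ∀ u v : E, Ω ![I • u, I • v] = Ω ![u, v])
    (b : Module.Basis (ι ⊕ ι) ℂ E) {η : ι ⊕ ι → ℝ} (hη : ∀ j, η (Sum.inr j) = -η (Sum.inl j))
    (hb₁ : ∀ k l, Ω ![b k, I • b l] = if k = l then η k else 0) (hb₂ : ∀ k l, Ω ![b k, b l] = 0) (u v : E) :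
    Ω ![quaternionicOfBasis b u, quaternionicOfBasis b v] = Ω ![u, v] := by
  rw [apply₂_eq_sum_coord hΩI b hb₁ hb₂, apply₂_eq_sum_coord hΩI b hb₁ hb₂, equivFun_quaternionicOfBasis,
    equivFun_quaternionicOfBasis, Fintype.sum_sum_type, Fintype.sum_sum_type, add_comm]
  congr 1 <;> refine Finset.sum_congr rfl fun j _ ↦ ?_ <;>
    simp only [quaternionicCoord_apply_inl, quaternionicCoord_apply_inr, Complex.neg_re, Complex.neg_im,
      Complex.conj_re, Complex.conj_im, hη] <;> ring

/-- **Every complex frame indexed by `ι ⊕ ι` carries a linear hyperkähler structure with `J = J_b`**: the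
Hermitian metric `g₀(v, w) = Σ_k Re(z̄_k(v) z_k(w))` making `b` unitary and Joyce's `J₂` in these coordinates.
[cite: Joyce2007, §10.1.1 eq. (10.1)] -/
theorem exists_isLinearHyperkaehler_quaternionicOfBasis (b : Module.Basis (ι ⊕ ι) ℂ E) :
    ∃ g₀ : E →L[ℝ] E →L[ℝ] ℝ, IsLinearHyperkaehler g₀ (quaternionicOfBasis b) := by
  let f : E → E → ℝ := fun v w ↦ ∑ k, ((b.repr v k).re * (b.repr w k).re + (b.repr v k).im * (b.repr w k).im)
  have hz_add : ∀ v w k, b.repr (v + w) k = b.repr v k + b.repr w k := fun v w k ↦ by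
    rw [map_add, Finsupp.add_apply]
  have hz_smul : ∀ (r : ℝ) v k, b.repr (r • v) k = (r : ℂ) * b.repr v k := fun r v k ↦ by
    rw [← Complex.coe_smul, map_smul, Finsupp.smul_apply, smul_eq_mul]
  have hf1 : ∀ v₁ v₂ w, f (v₁ + v₂) w = f v₁ w + f v₂ w := fun v₁ v₂ w ↦ by
    simp only [f, hz_add, Complex.add_re, Complex.add_im, ← Finset.sum_add_distrib]
    exact Finset.sum_congr rfl fun k _ ↦ by ring
  have hf2 : ∀ (r : ℝ) v w, f (r • v) w = r • f v w := fun r v w ↦ by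
    simp only [f, hz_smul, Complex.re_ofReal_mul, Complex.im_ofReal_mul, smul_eq_mul, Finset.mul_sum]
    exact Finset.sum_congr rfl fun k _ ↦ by ring
  have hf3 : ∀ v w₁ w₂, f v (w₁ + w₂) = f v w₁ + f v w₂ := fun v w₁ w₂ ↦ by
    simp only [f, hz_add, Complex.add_re, Complex.add_im, ← Finset.sum_add_distrib]
    exact Finset.sum_congr rfl fun k _ ↦ by ring
  have hf4 : ∀ (r : ℝ) v w, f v (r • w) = r • f v w := fun r v w ↦ by
    simp only [f, hz_smul, Complex.re_ofReal_mul, Complex.im_ofReal_mul, smul_eq_mul, Finset.mul_sum]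
    exact Finset.sum_congr rfl fun k _ ↦ by ring
  let g₀ : E →L[ℝ] E →L[ℝ] ℝ := LinearMap.toContinuousLinearMap
    ((LinearMap.toContinuousLinearMap : (E →ₗ[ℝ] ℝ) ≃ₗ[ℝ] (E →L[ℝ] ℝ)).toLinearMap ∘ₗ LinearMap.mk₂ ℝ f hf1 hf2 hf3 hf4)
  have hg : ∀ v w, g₀ v w = f v w := fun v w ↦ rfl
  have hsymm : ∀ v w : E, g₀ v w = g₀ w v := fun v w ↦ by
    rw [hg, hg]
    exact Finset.sum_congr rfl fun k _ ↦ by ring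
  have hI_repr : ∀ v k, b.repr (I • v) k = I * b.repr v k := fun v k ↦ by
    rw [map_smul, Finsupp.smul_apply, smul_eq_mul]
  have hI : ∀ v w : E, g₀ (I • v) (I • w) = g₀ v w := fun v w ↦ by
    rw [hg, hg]
    refine Finset.sum_congr rfl fun k _ ↦ ?_
    simp only [hI_repr, Complex.mul_re, Complex.mul_im, Complex.I_re, Complex.I_im, zero_mul, one_mul, zero_sub,
      zero_add]
    ring
  have hpos : ∀ v : E, v ≠ 0 → 0 < g₀ v v := fun v hv ↦ by
    rw [hg]
    have hex : ∃ k, b.repr v k ≠ 0 := by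
      by_contra h
      exact hv (b.repr.map_eq_zero_iff.mp (Finsupp.ext fun k ↦ not_not.mp (not_exists.mp h k)))
    obtain ⟨k₀, hk₀⟩ := hex
    refine Finset.sum_pos' (fun k _ ↦ by nlinarith [mul_self_nonneg (b.repr v k).re, mul_self_nonneg (b.repr v k).im])
      ⟨k₀, Finset.mem_univ _, ?_⟩
    have h := Complex.normSq_pos.mpr hk₀
    rw [Complex.normSq_apply] at h
    exact h
  have hb₁ : ∀ k l, g₀ (b k) (b l) = if k = l then 1 else 0 := fun k l ↦ by
    rw [hg]
    simp only [f, Module.Basis.repr_self, Finsupp.single_apply]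
    by_cases hkl : k = l
    · subst hkl
      rw [if_pos rfl, Finset.sum_eq_single k]
      · simp
      · intro m _ hm
        simp [Ne.symm hm]
      · intro h; exact absurd (Finset.mem_univ k) h
    · rw [if_neg hkl]
      refine Finset.sum_eq_zero fun m _ ↦ ?_
      by_cases hkm : k = m
      · subst hkm; simp [Ne.symm hkl]
      · simp [hkm]
  have hb₂ : ∀ k l, g₀ (I • b k) (b l) = 0 := fun k l ↦ by
    rw [hg]
    refine Finset.sum_eq_zero fun m _ ↦ ?_
    simp only [hI_repr, Module.Basis.repr_self, Finsupp.single_apply, Complex.mul_re, Complex.mul_im, Complex.I_re,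
      Complex.I_im, zero_mul, one_mul, zero_sub, zero_add]
    split_ifs <;> simp
  exact ⟨g₀, isLinearHyperkaehler_quaternionicOfBasis hsymm hpos hI b hb₁ hb₂⟩

/-- **The converse, as printed: from an `h`-adapted frame to an anticommuting `J` leaving `Ω` invariant.**
Let `Ω` be `I`-invariant and let `b` be a complex frame indexed by `ι ⊕ ι`, `h`-orthogonal with
`h(b_{inl j}, b_{inl j}) = η_j = −h(b_{inr j}, b_{inr j})` (Buskin–Izadi's data, with `k = n₊ = n₋`: `u_1 … u_k`
`h`-orthonormal in `V₊`, `v_1 … v_k` `(−h)`-orthonormal in `V₋`, and the basis `w_1 … w_l` of `V₀`, `l` even, split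
into pairs — take `ι = Fin k ⊕ Fin (l/2)`, `η = 1` resp. `0`). Then there is a linear hyperkähler structure
`(g₀, I, J, K)` on `E` whose `J` leaves `Ω` invariant (`J = J_b`: "Define `J : V_ℝ → V_ℝ` by setting `J(u_1) = v_1`,
`J(Iu_1) = −Iv_1`, …, `J(v_1) = −u_1`, `J(Iv_1) = Iu_1`, … and, using that `l` is an even number, by setting
`J(w_1) = w_2`, `J(Iw_1) = −Iw_2`, `J(w_2) = −w_1`, … Then `J` anticommutes with `I` and […] `Ω` is `J`-invariant"),
i.e. the twistor line `S(I, J)` lies in `Compl_Ω`. The existence of such a frame when `n₊ = n₋` (Sylvester / an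
`h`-orthogonal decomposition `V₊ ⊕ V₋ ⊕ V₀`) is the part of the printed sentence NOT formalised here.
[cite: BuskinIzadi2020TwistorLinesTori, §5 proof of Thm. 5.4 (arXiv v2 p.26 L40–p.27 L7)] [cite: Joyce2007, §10.1.1 eq. (10.1)] -/
theorem exists_isLinearHyperkaehler_invariant_of_adapted_basis {Ω : E [⋀^Fin 2]→L[ℝ] ℝ}
    (hΩI : ∀ u v : E, Ω ![I • u, I • v] = Ω ![u, v]) (b : Module.Basis (ι ⊕ ι) ℂ E) {η : ι ⊕ ι → ℝ}
    (hη : ∀ j, η (Sum.inr j) = -η (Sum.inl j)) (hb₁ : ∀ k l, Ω ![b k, I • b l] = if k = l then η k else 0)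
    (hb₂ : ∀ k l, Ω ![b k, b l] = 0) :
    ∃ (g₀ : E →L[ℝ] E →L[ℝ] ℝ) (J : E →L[ℝ] E), IsLinearHyperkaehler g₀ J ∧
      (∀ u v : E, Ω ![J u, J v] = Ω ![u, v]) ∧ adAlt J Ω = 0 := by
  obtain ⟨g₀, hk⟩ := exists_isLinearHyperkaehler_quaternionicOfBasis b
  have hΩJ : ∀ u v : E, Ω ![quaternionicOfBasis b u, quaternionicOfBasis b v] = Ω ![u, v] :=
    apply₂_quaternionicOfBasis hΩI b hη hb₁ hb₂
  exact ⟨g₀, quaternionicOfBasis b, hk, hΩJ,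
    (IsLinearHyperkaehler.adAlt_eq_zero_iff_apply₂_invariant hk.J_J).mpr hΩJ⟩

/-- **Group level**: with the data of `exists_isLinearHyperkaehler_invariant_of_adapted_basis`, `Ω` is invariant
under the whole isotropy group `SU(2)` of `(g₀, I, J_b, K)` (`ad I Ω = 0` from `I`-invariance, `ad J Ω = 0`), i.e. —
for the constant `2`-forms of a flat complex torus — `[Ω]` stays of type `(1,1)` along the twistor line `S(I, J_b)`.
[cite: BuskinIzadi2020TwistorLinesTori, §5 proof of Thm. 5.4 (arXiv v2 p.26 L26–28, p.27 L4–7)] [cite: Verbitsky1996Hyperholomorphic, §1 Prop. 1.1 and Prop. 1.2] -/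
theorem exists_isLinearHyperkaehler_forall_quaternion_invariant_of_adapted_basis {Ω : E [⋀^Fin 2]→L[ℝ] ℝ}
    (hΩI : ∀ u v : E, Ω ![I • u, I • v] = Ω ![u, v]) (b : Module.Basis (ι ⊕ ι) ℂ E) {η : ι ⊕ ι → ℝ}
    (hη : ∀ j, η (Sum.inr j) = -η (Sum.inl j)) (hb₁ : ∀ k l, Ω ![b k, I • b l] = if k = l then η k else 0)
    (hb₂ : ∀ k l, Ω ![b k, b l] = 0) :
    ∃ (g₀ : E →L[ℝ] E →L[ℝ] ℝ) (J : E →L[ℝ] E), IsLinearHyperkaehler g₀ J ∧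
      ∀ a b' c d : ℝ, a ^ 2 + b' ^ 2 + c ^ 2 + d ^ 2 = 1 →
        Ω.compContinuousLinearMap (a • ContinuousLinearMap.id ℝ E + b' • opI E + c • J + d • opK J) = Ω := by
  obtain ⟨g₀, J, hk, hΩJ, hadJ⟩ := exists_isLinearHyperkaehler_invariant_of_adapted_basis hΩI b hη hb₁ hb₂
  have hadI : adAlt (opI E) Ω = 0 :=
    (IsLinearHyperkaehler.adAlt_eq_zero_iff_apply₂_invariant (T := opI E) (fun v ↦ by
      simp [opI, smul_smul, Complex.I_mul_I])).mpr (fun u v ↦ by simpa [opI] using hΩI u v)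
  exact ⟨g₀, J, hk, hk.forall_compContinuousLinearMap_quaternion_iff.mpr ⟨hadI, hadJ⟩⟩

end Converse

/-! ## §8 Sylvester's step: an `h`-orthogonal complex frame exists and can be normalised and re-indexed
([BI20] p.26 L42–48 via the tree's `Motives.hermitianEigVecBasis`) -/

section Sylvester

/-- **The hermitian form of an `I`-invariant real `2`-form as a sesquilinear map** (conjugate-linear in the first
variable, Mathlib's convention): `H(u, v) = Ω(u, Iv) + iΩ(u, v) = conj h(u, v) = h(v, u)` for Buskin–Izadi's
`h(u, v) = Ω(u, Iv) − iΩ(u, v)`; it is Hermitian (`LinearMap.IsSymm` for sesquilinear maps). Existence form, so that no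
definition is introduced. [cite: BuskinIzadi2020TwistorLinesTori, §5 (arXiv v2 p.23 L20–25)] -/
theorem exists_sesqForm {Ω : E [⋀^Fin 2]→L[ℝ] ℝ} (hΩI : ∀ u v : E, Ω ![I • u, I • v] = Ω ![u, v]) :
    ∃ H : E →ₗ⋆[ℂ] E →ₗ[ℂ] ℂ, H.IsSymm ∧
      ∀ u v : E, H u v = ((Ω ![u, I • v] : ℝ) : ℂ) + I * ((Ω ![u, v] : ℝ) : ℂ) := by
  let f : E → E → ℂ := fun u v ↦ ((Ω ![u, I • v] : ℝ) : ℂ) + I * ((Ω ![u, v] : ℝ) : ℂ)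
  have hIu : ∀ u v : E, Ω ![I • u, v] = -Ω ![u, I • v] := fun u v ↦ by
    have e := hΩI u (I • v)
    rw [smul_smul, Complex.I_mul_I, neg_one_smul, apply₂_neg_right] at e
    linarith
  have hadd₁ : ∀ u₁ u₂ v, f (u₁ + u₂) v = f u₁ v + f u₂ v := fun u₁ u₂ v ↦ by
    simp only [f, apply₂_add_left, Complex.ofReal_add]; ring
  have hadd₂ : ∀ u v₁ v₂, f u (v₁ + v₂) = f u v₁ + f u v₂ := fun u v₁ v₂ ↦ by
    simp only [f, smul_add, apply₂_add_right, Complex.ofReal_add]; ring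
  have hII : ∀ w : E, I • I • w = -w := fun w ↦ by rw [smul_smul, Complex.I_mul_I, neg_one_smul]
  have hsmul₁ : ∀ (c : ℂ) u v, f (c • u) v = conj c * f u v := fun c u v ↦ by
    simp only [f]
    rw [Literature.NumberTheory.Transcendental.smul_eq_re_smul_add_im_smul c u]
    simp only [apply₂_add_left, apply₂_smul_left, smul_eq_mul, hIu, hII, apply₂_neg_right, Complex.ofReal_add,
      Complex.ofReal_mul, Complex.ofReal_neg]
    conv_rhs => rw [← Complex.re_add_im c]
    simp only [map_add, map_mul, Complex.conj_ofReal, Complex.conj_I]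
    ring_nf
    rw [Complex.I_sq]
    ring
  have hsmul₂ : ∀ (c : ℂ) u v, f u (c • v) = c * f u v := fun c u v ↦ by
    simp only [f]
    rw [Literature.NumberTheory.Transcendental.smul_eq_re_smul_add_im_smul c v]
    simp only [smul_add, apply₂_add_right, ← smul_comm (c.re : ℝ) I v, ← smul_comm (c.im : ℝ) I (I • v),
      apply₂_smul_right, smul_eq_mul, hII, apply₂_neg_right, Complex.ofReal_add, Complex.ofReal_mul,
      Complex.ofReal_neg]
    conv_rhs => rw [← Complex.re_add_im c]
    ring_nf
    rw [Complex.I_sq]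
    ring
  refine ⟨LinearMap.mk₂'ₛₗ (starRingEnd ℂ) (RingHom.id ℂ) f hadd₁ hsmul₁ hadd₂ hsmul₂, ⟨fun u v ↦ ?_⟩, fun u v ↦ rfl⟩
  show conj (f u v) = f v u
  have hsym : Ω ![v, I • u] = Ω ![u, I • v] := by
    have e : Ω ![I • u, I • (I • v)] = Ω ![u, I • v] := hΩI u (I • v)
    rw [hII, apply₂_neg_right] at e
    rw [← e, apply₂_swap Ω v (I • u), neg_neg]
  simp only [f, map_add, map_mul, Complex.conj_ofReal, Complex.conj_I]
  rw [hsym, apply₂_swap Ω u v, Complex.ofReal_neg]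
  ring

variable [FiniteDimensional ℂ E]

/-- **An `h`-orthogonal complex frame exists** (the `h`-orthogonal decomposition / orthogonal bases of [BI20] p.26
L42–48, via the spectral theorem for the Gram matrix = the tree's `Motives.hermitianEigVecBasis`, Gohberg–Lancaster–Rodman
Thm. A.1.1): for an `I`-invariant real `2`-form `Ω` there are a complex basis `b` and real numbers `d_k` with
`h(b_k, b_l) = d_k δ_{kl}`, i.e. `Ω(b_k, I b_l) = d_k δ_{kl}` and `Ω(b_k, b_l) = 0`.
[cite: BuskinIzadi2020TwistorLinesTori, §5 proof of Thm. 5.4 (arXiv v2 p.26 L42–48)] [cite: GohbergLancasterRodman2005, §2.3 (2.3.8) and Thm. A.1.1] -/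
theorem exists_orthogonal_frame {Ω : E [⋀^Fin 2]→L[ℝ] ℝ} (hΩI : ∀ u v : E, Ω ![I • u, I • v] = Ω ![u, v]) :
    ∃ (b : Module.Basis (Fin (finrank ℂ E)) ℂ E) (d : Fin (finrank ℂ E) → ℝ),
      (∀ k l, Ω ![b k, I • b l] = if k = l then d k else 0) ∧ (∀ k l, Ω ![b k, b l] = 0) := by
  classical
  obtain ⟨H, hH, hHf⟩ := exists_sesqForm hΩI
  let b₀ := Module.finBasis ℂ E
  let hG := Literature.AlgebraicGeometry.Motives.isHermitian_gramMatrix hH b₀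
  refine ⟨Literature.AlgebraicGeometry.Motives.hermitianEigVecBasis hH b₀, fun k ↦ hG.eigenvalues k, ?_, ?_⟩
  · intro k l
    have e := hHf (Literature.AlgebraicGeometry.Motives.hermitianEigVecBasis hH b₀ k)
      (Literature.AlgebraicGeometry.Motives.hermitianEigVecBasis hH b₀ l)
    rw [Literature.AlgebraicGeometry.Motives.hermitianEigVecBasis_apply,
      Literature.AlgebraicGeometry.Motives.hermitianEigVecBasis_apply,
      Literature.AlgebraicGeometry.Motives.apply_hermitianEigVec] at e
    have er := congrArg Complex.re e
    simp only [Complex.add_re, Complex.ofReal_re, Complex.mul_re, Complex.I_re, Complex.I_im, Complex.ofReal_im,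
      zero_mul, mul_zero, sub_zero, add_zero, apply_ite Complex.re, Complex.zero_re] at er
    rw [Literature.AlgebraicGeometry.Motives.hermitianEigVecBasis_apply,
      Literature.AlgebraicGeometry.Motives.hermitianEigVecBasis_apply]
    exact er.symm
  · intro k l
    have e := hHf (Literature.AlgebraicGeometry.Motives.hermitianEigVecBasis hH b₀ k)
      (Literature.AlgebraicGeometry.Motives.hermitianEigVecBasis hH b₀ l)
    rw [Literature.AlgebraicGeometry.Motives.hermitianEigVecBasis_apply,
      Literature.AlgebraicGeometry.Motives.hermitianEigVecBasis_apply,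
      Literature.AlgebraicGeometry.Motives.apply_hermitianEigVec] at e
    have ei := congrArg Complex.im e
    simp only [Complex.add_im, Complex.ofReal_im, Complex.mul_im, Complex.I_re, Complex.I_im, Complex.ofReal_re,
      zero_mul, one_mul, zero_add, apply_ite Complex.im, Complex.zero_im, ite_self] at ei
    rw [Literature.AlgebraicGeometry.Motives.hermitianEigVecBasis_apply,
      Literature.AlgebraicGeometry.Motives.hermitianEigVecBasis_apply]
    exact ei.symm

omit [FiniteDimensional ℂ E] in
/-- Real rescaling inside `Ω`: `Ω((r : ℂ) • u, I • (s : ℂ) • v) = r s Ω(u, I v)` (private plumbing). [folklore] -/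
private theorem apply₂_real_smul (Ω : E [⋀^Fin 2]→L[ℝ] ℝ) (r s : ℝ) (u v : E) :
    Ω ![(r : ℂ) • u, (s : ℂ) • v] = r * s * Ω ![u, v] := by
  rw [Complex.coe_smul, Complex.coe_smul, apply₂_smul_left, apply₂_smul_right, smul_eq_mul, smul_eq_mul, mul_assoc]

omit [FiniteDimensional ℂ E] in
/-- **Normalising an `h`-orthogonal frame** ([BI20]: "`h`-orthonormal and, respectively, `−h`-orthonormal bases"):
rescaling `b_k` by `|d_k|^{−1/2}` (and leaving the null vectors) gives a frame with `h(b'_k, b'_k) ∈ {1, −1, 0}`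
according to the sign of `d_k`. [cite: BuskinIzadi2020TwistorLinesTori, §5 proof of Thm. 5.4 (arXiv v2 p.26 L47–48)] -/
theorem exists_normalised_frame {ι : Type*} [Fintype ι] [DecidableEq ι] {Ω : E [⋀^Fin 2]→L[ℝ] ℝ}
    (b : Module.Basis ι ℂ E) {d : ι → ℝ} (hb₁ : ∀ k l, Ω ![b k, I • b l] = if k = l then d k else 0)
    (hb₂ : ∀ k l, Ω ![b k, b l] = 0) :
    ∃ b' : Module.Basis ι ℂ E,
      (∀ k l, Ω ![b' k, I • b' l] = if k = l then (if 0 < d k then 1 else if d k < 0 then -1 else 0) else 0) ∧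
      (∀ k l, Ω ![b' k, b' l] = 0) := by
  -- the scaling factors
  let r : ι → ℝ := fun i ↦ if d i = 0 then 1 else (Real.sqrt |d i|)⁻¹
  have hr0 : ∀ i, r i ≠ 0 := fun i ↦ by
    by_cases h : d i = 0
    · simp [r, h]
    · have : 0 < Real.sqrt |d i| := Real.sqrt_pos.mpr (abs_pos.mpr h)
      simp [r, h, this.ne']
  have hrr : ∀ i, r i * r i * d i = if 0 < d i then 1 else if d i < 0 then -1 else 0 := fun i ↦ by
    by_cases h : d i = 0
    · simp [r, h]
    · have habs : 0 < |d i| := abs_pos.mpr h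
      have hs : Real.sqrt |d i| * Real.sqrt |d i| = |d i| := Real.mul_self_sqrt habs.le
      have hne : Real.sqrt |d i| ≠ 0 := (Real.sqrt_pos.mpr habs).ne'
      have e1 : r i * r i * d i = d i / |d i| := by
        simp only [r, h, if_false]
        field_simp
        rw [sq, hs]
      rw [e1]
      rcases lt_or_gt_of_ne h with hlt | hgt
      · rw [abs_of_neg hlt, if_neg (not_lt.mpr hlt.le), if_pos hlt, div_neg, div_self h]
      · rw [abs_of_pos hgt, if_pos hgt, div_self h]
  let w : ι → ℂˣ := fun i ↦ Units.mk0 ((r i : ℝ) : ℂ) (by exact_mod_cast hr0 i)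
  refine ⟨b.unitsSMul w, fun k l ↦ ?_, fun k l ↦ ?_⟩
  · rw [Module.Basis.unitsSMul_apply, Module.Basis.unitsSMul_apply, Units.smul_def, Units.smul_def,
      ← smul_comm ((w l : ℂ)) I (b l)]
    show Ω ![((r k : ℝ) : ℂ) • b k, ((r l : ℝ) : ℂ) • I • b l] = _
    rw [apply₂_real_smul, hb₁]
    by_cases hkl : k = l
    · subst hkl; rw [if_pos rfl, if_pos rfl, hrr]
    · rw [if_neg hkl, if_neg hkl, mul_zero]
  · rw [Module.Basis.unitsSMul_apply, Module.Basis.unitsSMul_apply, Units.smul_def, Units.smul_def]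
    show Ω ![((r k : ℝ) : ℂ) • b k, ((r l : ℝ) : ℂ) • b l] = 0
    rw [apply₂_real_smul, hb₂, mul_zero]

omit [FiniteDimensional ℂ E] in
/-- **Re-indexing a normalised frame as Buskin–Izadi's `(u_i ∣ w_odd) ⊕ (v_i ∣ w_even)`**: if the numbers of positive and
of negative diagonal entries agree (`k = n₊ = n₋`) and the number of null ones is even (`l = n₀`), an `h`-orthogonal
frame can be re-indexed by `κ ⊕ κ`, `κ = {positive indices} ⊕ Fin (l/2)`, so that `h(B_{inl j}, B_{inl j}) = η_j =
−h(B_{inr j}, B_{inr j})` with `η ∈ {1, 0}` — the input of `apply₂_quaternionicOfBasis`.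
[cite: BuskinIzadi2020TwistorLinesTori, §5 proof of Thm. 5.4 (arXiv v2 p.26 L42–p.27 L3)] -/
theorem exists_adapted_frame {ι : Type*} [Fintype ι] [DecidableEq ι] {Ω : E [⋀^Fin 2]→L[ℝ] ℝ}
    (b : Module.Basis ι ℂ E) {d : ι → ℝ} (hb₁ : ∀ k l, Ω ![b k, I • b l] = if k = l then d k else 0)
    (hb₂ : ∀ k l, Ω ![b k, b l] = 0)
    (hcard : Fintype.card {i // 0 < d i} = Fintype.card {i // d i < 0})
    (heven : Even (Fintype.card {i // d i = 0})) :
    ∃ (B : Module.Basis (({i // 0 < d i} ⊕ Fin (Fintype.card {i // d i = 0} / 2)) ⊕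
        ({i // 0 < d i} ⊕ Fin (Fintype.card {i // d i = 0} / 2))) ℂ E)
      (η : ({i // 0 < d i} ⊕ Fin (Fintype.card {i // d i = 0} / 2)) ⊕
        ({i // 0 < d i} ⊕ Fin (Fintype.card {i // d i = 0} / 2)) → ℝ),
      (∀ j, η (Sum.inr j) = -η (Sum.inl j)) ∧ (∀ k l, Ω ![B k, I • B l] = if k = l then η k else 0) ∧
        ∀ k l, Ω ![B k, B l] = 0 := by
  classical
  obtain ⟨b', hb'₁, hb'₂⟩ := exists_normalised_frame b hb₁ hb₂
  obtain ⟨m', hm'⟩ := heven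
  set m := Fintype.card {i // d i = 0} / 2 with hm
  have hmm : Fintype.card {i // d i = 0} = m + m := by omega
  let P := {i // 0 < d i}
  let eN : {i // d i < 0} ≃ P := Fintype.equivOfCardEq hcard.symm
  let eZ : {i // d i = 0} ≃ Fin m ⊕ Fin m := (Fintype.equivFinOfCardEq hmm).trans finSumFinEquiv.symm
  let g : (P ⊕ Fin m) ⊕ (P ⊕ Fin m) → ι :=
    Sum.elim (Sum.elim (fun p ↦ p.1) (fun t ↦ (eZ.symm (Sum.inl t)).1))
      (Sum.elim (fun p ↦ (eN.symm p).1) (fun t ↦ (eZ.symm (Sum.inr t)).1))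
  have hP : ∀ p : P, 0 < d p.1 := fun p ↦ p.2
  have hN : ∀ p : P, d (eN.symm p).1 < 0 := fun p ↦ (eN.symm p).2
  have hZl : ∀ t : Fin m, d (eZ.symm (Sum.inl t)).1 = 0 := fun t ↦ (eZ.symm (Sum.inl t)).2
  have hZr : ∀ t : Fin m, d (eZ.symm (Sum.inr t)).1 = 0 := fun t ↦ (eZ.symm (Sum.inr t)).2
  have hinj : Function.Injective g := by
    intro x y hxy
    rcases x with (p | t) | (p | t) <;> rcases y with (p' | t') | (p' | t') <;>
      simp only [g, Sum.elim_inl, Sum.elim_inr] at hxy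
    · cases Subtype.ext hxy; rfl
    · exact absurd (hP p) (by rw [hxy, hZl]; exact lt_irrefl 0)
    · exact absurd (hP p) (by rw [hxy]; exact not_lt.mpr (hN p').le)
    · exact absurd (hP p) (by rw [hxy, hZr]; exact lt_irrefl 0)
    · exact absurd (hP p') (by rw [← hxy, hZl]; exact lt_irrefl 0)
    · cases eZ.symm.injective (Subtype.ext hxy); rfl
    · exact absurd (hN p') (by rw [← hxy, hZl]; exact lt_irrefl 0)
    · exact absurd (eZ.symm.injective (Subtype.ext hxy)) Sum.inl_ne_inr
    · exact absurd (hP p') (by rw [← hxy]; exact not_lt.mpr (hN p).le)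
    · exact absurd (hN p) (by rw [hxy, hZl]; exact lt_irrefl 0)
    · cases eN.symm.injective (Subtype.ext hxy); rfl
    · exact absurd (hN p) (by rw [hxy, hZr]; exact lt_irrefl 0)
    · exact absurd (hP p') (by rw [← hxy, hZr]; exact lt_irrefl 0)
    · exact absurd (eZ.symm.injective (Subtype.ext hxy)) Sum.inr_ne_inl
    · exact absurd (hN p') (by rw [← hxy, hZr]; exact lt_irrefl 0)
    · cases eZ.symm.injective (Subtype.ext hxy); rfl
  have hsurj : Function.Surjective g := by
    intro i
    rcases lt_trichotomy (d i) 0 with h | h | h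
    · exact ⟨Sum.inr (Sum.inl (eN ⟨i, h⟩)), by simp [g]⟩
    · rcases hz : eZ ⟨i, h⟩ with t | t
      · exact ⟨Sum.inl (Sum.inr t), by simp [g, ← hz]⟩
      · exact ⟨Sum.inr (Sum.inr t), by simp [g, ← hz]⟩
    · exact ⟨Sum.inl (Sum.inl ⟨i, h⟩), by simp [g]⟩
  let e := Equiv.ofBijective g ⟨hinj, hsurj⟩
  let B := b'.reindex e.symm
  have hB : ∀ x, B x = b' (g x) := fun x ↦ by
    simp only [B, Module.Basis.reindex_apply, Equiv.symm_symm, Equiv.ofBijective_apply, e]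
  let η : (P ⊕ Fin m) ⊕ (P ⊕ Fin m) → ℝ := fun x ↦ if 0 < d (g x) then 1 else if d (g x) < 0 then -1 else 0
  refine ⟨B, η, ?_, ?_, ?_⟩
  · rintro (p | t)
    · have h1 : η (Sum.inl (Sum.inl p)) = 1 := by simp only [η, g, Sum.elim_inl, if_pos (hP p)]
      have h2 : η (Sum.inr (Sum.inl p)) = -1 := by
        simp only [η, g, Sum.elim_inl, Sum.elim_inr, if_neg (not_lt.mpr (hN p).le), if_pos (hN p)]
      rw [h1, h2]
    · have h1 : η (Sum.inl (Sum.inr t)) = 0 := by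
        simp only [η, g, Sum.elim_inl, Sum.elim_inr, hZl, lt_irrefl, if_false]
      have h2 : η (Sum.inr (Sum.inr t)) = 0 := by
        simp only [η, g, Sum.elim_inr, hZr, lt_irrefl, if_false]
      rw [h1, h2, neg_zero]
  · intro k l
    rw [hB, hB, hb'₁]
    by_cases hkl : k = l
    · subst hkl; simp only [if_true, η]
    · rw [if_neg (hinj.ne hkl), if_neg hkl]
  · intro k l
    rw [hB, hB, hb'₂]

end Sylvester

/-- **The converse with counting hypotheses ([BI20] p.26 L40–p.27 L7 in full, given the frame): from ANY
`h`-orthogonal complex frame with as many positive as negative diagonal entries and an even number of null ones, a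
linear hyperkähler structure `(g₀, I, J, K)` with `Ω` `J`-invariant (`ad J Ω = 0`).**
[cite: BuskinIzadi2020TwistorLinesTori, §5 proof of Thm. 5.4 (arXiv v2 p.26 L40–p.27 L7)] [cite: Joyce2007, §10.1.1 eq. (10.1)] -/
theorem exists_isLinearHyperkaehler_invariant_of_card_pos_eq_card_neg {ι : Type*} [Fintype ι] [DecidableEq ι]
    {Ω : E [⋀^Fin 2]→L[ℝ] ℝ} (hΩI : ∀ u v : E, Ω ![I • u, I • v] = Ω ![u, v]) (b : Module.Basis ι ℂ E) {d : ι → ℝ}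
    (hb₁ : ∀ k l, Ω ![b k, I • b l] = if k = l then d k else 0) (hb₂ : ∀ k l, Ω ![b k, b l] = 0)
    (hcard : Fintype.card {i // 0 < d i} = Fintype.card {i // d i < 0})
    (heven : Even (Fintype.card {i // d i = 0})) :
    ∃ (g₀ : E →L[ℝ] E →L[ℝ] ℝ) (J : E →L[ℝ] E), IsLinearHyperkaehler g₀ J ∧
      (∀ u v : E, Ω ![J u, J v] = Ω ![u, v]) ∧ adAlt J Ω = 0 := by
  classical
  haveI : FiniteDimensional ℂ E := Module.Finite.of_basis b
  obtain ⟨B, η, hη, hB₁, hB₂⟩ := exists_adapted_frame b hb₁ hb₂ hcard heven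
  exact exists_isLinearHyperkaehler_invariant_of_adapted_basis hΩI B hη hB₁ hB₂


/-! ## §9 Sylvester's law for `h`: in any `h`-orthogonal frame the number of positive (negative) diagonal entries is the
largest complex dimension of a positive (negative) subspace; `J` carries complex subspaces to complex subspaces of the
same dimension; hence the printed criterion in intrinsic form -/

section Counts

variable {ι : Type*} [Fintype ι] [DecidableEq ι]

/-- **`h(u, u) = Σ_k d_k |z_k(u)|²`** in an `h`-orthogonal frame. [cite: BuskinIzadi2020TwistorLinesTori, §5 (arXiv v2 p.23 L20–30)] -/
theorem apply₂_self_I_eq_sum {Ω : E [⋀^Fin 2]→L[ℝ] ℝ} (hΩI : ∀ u v : E, Ω ![I • u, I • v] = Ω ![u, v])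
    (b : Module.Basis ι ℂ E) {d : ι → ℝ} (hb₁ : ∀ k l, Ω ![b k, I • b l] = if k = l then d k else 0)
    (hb₂ : ∀ k l, Ω ![b k, b l] = 0) (u : E) :
    Ω ![u, I • u] = ∑ k, d k * Complex.normSq (b.equivFun u k) := by
  rw [apply₂_eq_sum_coord hΩI b hb₁ hb₂]
  refine Finset.sum_congr rfl fun k _ ↦ ?_
  rw [map_smul, Pi.smul_apply, smul_eq_mul, Complex.normSq_apply, Complex.mul_re, Complex.mul_im, Complex.I_re,
    Complex.I_im]
  ring

/-- **Inertia, upper bound**: a complex subspace on which `h > 0` has dimension at most the number of positive diagonal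
entries of any `h`-orthogonal frame (it meets the span of the non-positive frame vectors trivially).
[cite: GohbergLancasterRodman2005, §2.3 Thm. 2.3.2] [cite: BuskinIzadi2020TwistorLinesTori, §5 (arXiv v2 p.23 L26–30: "a maximal positive subspace V₊")] -/
theorem finrank_le_card_pos {Ω : E [⋀^Fin 2]→L[ℝ] ℝ} (hΩI : ∀ u v : E, Ω ![I • u, I • v] = Ω ![u, v])
    (b : Module.Basis ι ℂ E) {d : ι → ℝ} (hb₁ : ∀ k l, Ω ![b k, I • b l] = if k = l then d k else 0)
    (hb₂ : ∀ k l, Ω ![b k, b l] = 0) {Q : Submodule ℂ E} (hQ : ∀ v ∈ Q, v ≠ 0 → 0 < Ω ![v, I • v]) :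
    finrank ℂ Q ≤ Fintype.card {i // 0 < d i} := by
  classical
  haveI : FiniteDimensional ℂ E := Module.Finite.of_basis b
  let π : E →ₗ[ℂ] ({i // 0 < d i} → ℂ) :=
    { toFun := fun u i ↦ b.equivFun u i.1
      map_add' := fun u v ↦ by ext i; simp only [map_add, Pi.add_apply]
      map_smul' := fun c u ↦ by ext i; simp only [map_smul, Pi.smul_apply, RingHom.id_apply] }
  have hπ : ∀ u i, π u i = b.equivFun u i.1 := fun _ _ ↦ rfl
  have hsurj : Function.Surjective π := by
    intro f
    refine ⟨b.equivFun.symm (fun k ↦ if h : 0 < d k then f ⟨k, h⟩ else 0), ?_⟩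
    ext i
    rw [hπ, LinearEquiv.apply_symm_apply, dif_pos i.2]
  have hker : finrank ℂ (LinearMap.ker π) + Fintype.card {i // 0 < d i} = finrank ℂ E := by
    have h := LinearMap.finrank_range_add_finrank_ker π
    rw [LinearMap.range_eq_top.mpr hsurj, finrank_top, Module.finrank_fintype_fun_eq_card] at h
    omega
  have hinf : Q ⊓ LinearMap.ker π = ⊥ := by
    rw [Submodule.eq_bot_iff]
    rintro u ⟨huQ, huK⟩
    by_contra hu
    have hpos := hQ u huQ hu
    rw [apply₂_self_I_eq_sum hΩI b hb₁ hb₂] at hpos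
    have hz : ∀ k, 0 < d k → b.equivFun u k = 0 := fun k hk ↦ by
      have e := congr_fun (LinearMap.mem_ker.mp huK) ⟨k, hk⟩
      rwa [hπ] at e
    have hle : ∑ k, d k * Complex.normSq (b.equivFun u k) ≤ 0 := by
      refine Finset.sum_nonpos fun k _ ↦ ?_
      by_cases hk : 0 < d k
      · rw [hz k hk, map_zero, mul_zero]
      · exact mul_nonpos_of_nonpos_of_nonneg (not_lt.mp hk) (Complex.normSq_nonneg _)
    exact absurd hpos (not_lt.mpr hle)
  have h := Submodule.finrank_sup_add_finrank_inf_eq Q (LinearMap.ker π)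
  rw [hinf, finrank_bot, add_zero] at h
  have hle := Submodule.finrank_le (Q ⊔ LinearMap.ker π)
  omega

/-- **Inertia, attained**: the span of the positive frame vectors is a complex subspace on which `h > 0`, of dimension
the number of positive diagonal entries. [cite: GohbergLancasterRodman2005, §2.3 Thm. 2.3.2] [cite: BuskinIzadi2020TwistorLinesTori, §5 (arXiv v2 p.23 L26–30)] -/
theorem exists_pos_submodule_finrank_eq_card {Ω : E [⋀^Fin 2]→L[ℝ] ℝ}
    (hΩI : ∀ u v : E, Ω ![I • u, I • v] = Ω ![u, v]) (b : Module.Basis ι ℂ E) {d : ι → ℝ}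
    (hb₁ : ∀ k l, Ω ![b k, I • b l] = if k = l then d k else 0) (hb₂ : ∀ k l, Ω ![b k, b l] = 0) :
    ∃ P : Submodule ℂ E, (∀ v ∈ P, v ≠ 0 → 0 < Ω ![v, I • v]) ∧ finrank ℂ P = Fintype.card {i // 0 < d i} := by
  classical
  haveI : FiniteDimensional ℂ E := Module.Finite.of_basis b
  let π : E →ₗ[ℂ] ({i // ¬ 0 < d i} → ℂ) :=
    { toFun := fun u i ↦ b.equivFun u i.1
      map_add' := fun u v ↦ by ext i; simp only [map_add, Pi.add_apply]
      map_smul' := fun c u ↦ by ext i; simp only [map_smul, Pi.smul_apply, RingHom.id_apply] }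
  have hπ : ∀ u i, π u i = b.equivFun u i.1 := fun _ _ ↦ rfl
  have hsurj : Function.Surjective π := by
    intro f
    refine ⟨b.equivFun.symm (fun k ↦ if h : ¬ 0 < d k then f ⟨k, h⟩ else 0), ?_⟩
    ext i
    rw [hπ, LinearEquiv.apply_symm_apply, dif_pos i.2]
  refine ⟨LinearMap.ker π, fun v hv hv0 ↦ ?_, ?_⟩
  · have hz : ∀ k, ¬ 0 < d k → b.equivFun v k = 0 := fun k hk ↦ by
      have e := congr_fun (LinearMap.mem_ker.mp hv) ⟨k, hk⟩
      rwa [hπ] at e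
    have hex : ∃ k, b.equivFun v k ≠ 0 := by
      by_contra h
      simp only [not_exists, not_not] at h
      exact hv0 (b.equivFun.map_eq_zero_iff.mp (funext h))
    obtain ⟨k₀, hk₀⟩ := hex
    have hk₀pos : 0 < d k₀ := by
      by_contra h
      exact hk₀ (hz k₀ h)
    rw [apply₂_self_I_eq_sum hΩI b hb₁ hb₂]
    refine Finset.sum_pos' (fun k _ ↦ ?_) ⟨k₀, Finset.mem_univ _, mul_pos hk₀pos (Complex.normSq_pos.mpr hk₀)⟩
    by_cases hk : 0 < d k
    · exact mul_nonneg hk.le (Complex.normSq_nonneg _)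
    · rw [hz k hk, map_zero, mul_zero]
  · have h := LinearMap.finrank_range_add_finrank_ker π
    rw [LinearMap.range_eq_top.mpr hsurj, finrank_top, Module.finrank_fintype_fun_eq_card,
      Fintype.card_subtype_compl, Module.finrank_eq_card_basis b] at h
    have hle : Fintype.card {i // 0 < d i} ≤ Fintype.card ι := Fintype.card_subtype_le _
    omega

/-- **`n₊` of the frame = the largest complex dimension of a positive subspace** (Sylvester's law of inertia for `h`,
degenerate forms allowed). [cite: GohbergLancasterRodman2005, §2.3 Thm. 2.3.2] [cite: BuskinIzadi2020TwistorLinesTori, §5 (arXiv v2 p.23 L26–30)] -/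
theorem card_pos_eq_finrank_of_maximal {Ω : E [⋀^Fin 2]→L[ℝ] ℝ} (hΩI : ∀ u v : E, Ω ![I • u, I • v] = Ω ![u, v])
    (b : Module.Basis ι ℂ E) {d : ι → ℝ} (hb₁ : ∀ k l, Ω ![b k, I • b l] = if k = l then d k else 0)
    (hb₂ : ∀ k l, Ω ![b k, b l] = 0) {P : Submodule ℂ E} (hP : ∀ v ∈ P, v ≠ 0 → 0 < Ω ![v, I • v])
    (hPmax : ∀ Q : Submodule ℂ E, (∀ v ∈ Q, v ≠ 0 → 0 < Ω ![v, I • v]) → finrank ℂ Q ≤ finrank ℂ P) :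
    Fintype.card {i // 0 < d i} = finrank ℂ P := by
  obtain ⟨P₀, hP₀, hP₀d⟩ := exists_pos_submodule_finrank_eq_card hΩI b hb₁ hb₂
  exact le_antisymm (hP₀d ▸ hPmax P₀ hP₀) (finrank_le_card_pos hΩI b hb₁ hb₂ hP)

/-- **`n₋` of the frame = the largest complex dimension of a negative subspace** (the previous statement for `−Ω`).
[cite: GohbergLancasterRodman2005, §2.3 Thm. 2.3.2] [cite: BuskinIzadi2020TwistorLinesTori, §5 (arXiv v2 p.23 L26–30)] -/
theorem card_neg_eq_finrank_of_maximal {Ω : E [⋀^Fin 2]→L[ℝ] ℝ} (hΩI : ∀ u v : E, Ω ![I • u, I • v] = Ω ![u, v])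
    (b : Module.Basis ι ℂ E) {d : ι → ℝ} (hb₁ : ∀ k l, Ω ![b k, I • b l] = if k = l then d k else 0)
    (hb₂ : ∀ k l, Ω ![b k, b l] = 0) {N : Submodule ℂ E} (hN : ∀ v ∈ N, v ≠ 0 → Ω ![v, I • v] < 0)
    (hNmax : ∀ Q : Submodule ℂ E, (∀ v ∈ Q, v ≠ 0 → Ω ![v, I • v] < 0) → finrank ℂ Q ≤ finrank ℂ N) :
    Fintype.card {i // d i < 0} = finrank ℂ N := by
  have hΩI' : ∀ u v : E, (-Ω) ![I • u, I • v] = (-Ω) ![u, v] := fun u v ↦ by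
    simp only [ContinuousAlternatingMap.neg_apply, hΩI]
  have hb₁' : ∀ k l, (-Ω) ![b k, I • b l] = if k = l then -d k else 0 := fun k l ↦ by
    rw [ContinuousAlternatingMap.neg_apply, hb₁]; split_ifs <;> simp
  have hb₂' : ∀ k l, (-Ω) ![b k, b l] = 0 := fun k l ↦ by rw [ContinuousAlternatingMap.neg_apply, hb₂, neg_zero]
  have hN' : ∀ v ∈ N, v ≠ 0 → 0 < (-Ω) ![v, I • v] := fun v hv h0 ↦ by
    rw [ContinuousAlternatingMap.neg_apply, neg_pos]; exact hN v hv h0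
  have hNmax' : ∀ Q : Submodule ℂ E, (∀ v ∈ Q, v ≠ 0 → 0 < (-Ω) ![v, I • v]) → finrank ℂ Q ≤ finrank ℂ N :=
    fun Q hQ ↦ hNmax Q fun v hv h0 ↦ by
      have h := hQ v hv h0
      rwa [ContinuousAlternatingMap.neg_apply, neg_pos] at h
  have h := card_pos_eq_finrank_of_maximal hΩI' b hb₁' hb₂' hN' hNmax'
  rw [← h]
  exact Fintype.card_congr (Equiv.subtypeEquivRight fun i ↦ by simp)

omit [DecidableEq ι] in
/-- Trichotomy count: `#pos + #neg + #null = #ι`. [folklore] -/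
private theorem card_pos_add_card_neg_add_card_null (d : ι → ℝ) :
    Fintype.card {i // 0 < d i} + Fintype.card {i // d i < 0} + Fintype.card {i // d i = 0} = Fintype.card ι := by
  classical
  rw [Fintype.card_subtype, Fintype.card_subtype, Fintype.card_subtype, Finset.card_filter, Finset.card_filter,
    Finset.card_filter, ← Finset.sum_add_distrib, ← Finset.sum_add_distrib, Finset.card_univ.symm,
    Finset.card_eq_sum_ones]
  refine Finset.sum_congr rfl fun i _ ↦ ?_
  rcases lt_trichotomy (d i) 0 with h | h | h
  · simp [h, h.ne, not_lt.mpr h.le]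
  · simp [h]
  · simp [h, h.ne', not_lt.mpr h.le]

end Counts

/-- **The conjugate-linear `J` carries a complex subspace onto a complex subspace of the same dimension** (its image
`J(P)` is `I`-stable since `I J = −J I`; `J` restricts to a real-linear bijection `P → J(P)`; complex dimension = half the
real one). [cite: BuskinIzadi2020TwistorLinesTori, §5 proof of Thm. 5.4 (arXiv v2 p.26 L36–38: "equivalent under J … the same signature")] -/
theorem exists_submodule_image_J (hJJ : ∀ v : E, J (J v) = -v) (hJI : ∀ v : E, J (I • v) = -(I • J v))
    (P : Submodule ℂ E) :
    ∃ N : Submodule ℂ E, (∀ w, w ∈ N ↔ ∃ v ∈ P, J v = w) ∧ finrank ℂ N = finrank ℂ P := by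
  have hconj : ∀ (c : ℂ) (v : E), J (c • v) = (starRingEnd ℂ c) • J v := fun c v ↦ by
    have hc : c • v = (c.re : ℝ) • v + (c.im : ℝ) • (I • v) := by
      conv_lhs => rw [← Complex.re_add_im c]
      rw [add_smul, mul_smul, Complex.coe_smul, Complex.coe_smul]
    have hc' : starRingEnd ℂ c • J v = (c.re : ℝ) • J v - (c.im : ℝ) • (I • J v) := by
      conv_lhs => rw [← Complex.re_add_im (starRingEnd ℂ c), Complex.conj_re, Complex.conj_im]
      rw [add_smul, mul_smul, Complex.coe_smul, Complex.coe_smul, neg_smul, ← sub_eq_add_neg]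
    rw [hc, hc', map_add, J.map_smul, J.map_smul, hJI, smul_neg, sub_eq_add_neg]
  let N : Submodule ℂ E :=
    { carrier := {w | ∃ v ∈ P, J v = w}
      add_mem' := by
        rintro _ _ ⟨v, hv, rfl⟩ ⟨v', hv', rfl⟩
        exact ⟨v + v', P.add_mem hv hv', map_add J v v'⟩
      zero_mem' := ⟨0, P.zero_mem, map_zero J⟩
      smul_mem' := by
        rintro c _ ⟨v, hv, rfl⟩
        refine ⟨starRingEnd ℂ c • v, P.smul_mem _ hv, ?_⟩
        rw [hconj, Complex.conj_conj] }
  refine ⟨N, fun w ↦ Iff.rfl, ?_⟩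
  let e : P ≃ₗ[ℝ] N :=
    { toFun := fun v ↦ ⟨J (v : E), v, v.2, rfl⟩
      map_add' := fun v w ↦ Subtype.ext (by simp only [Submodule.coe_add, map_add])
      map_smul' := fun r v ↦ Subtype.ext (by
        simp only [Submodule.coe_smul_of_tower, map_smul, RingHom.id_apply])
      invFun := fun w ↦ ⟨-J (w : E), by
        obtain ⟨v, hv, hw⟩ := w.2
        rw [← hw, hJJ, neg_neg]; exact hv⟩
      left_inv := fun v ↦ Subtype.ext (by simp [hJJ])
      right_inv := fun w ↦ Subtype.ext (by simp [hJJ]) }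
  have h1 : finrank ℝ P = finrank ℝ N := e.finrank_eq
  have h2 := finrank_real_of_complex P
  have h3 := finrank_real_of_complex N
  omega

/-- **`n₊ = n₋`, complex subspaces (the printed reading, intrinsic)**: if `Ω` is invariant under a complex-structure
operator `J` anticommuting with `I`, a positive complex subspace of maximal dimension and a negative complex subspace of
maximal dimension have the same complex dimension. [cite: BuskinIzadi2020TwistorLinesTori, §5 proof of Thm. 5.4 (arXiv v2 p.26 L29–38)] -/
theorem finrank_pos_eq_finrank_neg_complex (hJJ : ∀ v : E, J (J v) = -v) (hJI : ∀ v : E, J (I • v) = -(I • J v))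
    {Ω : E [⋀^Fin 2]→L[ℝ] ℝ} (hΩJ : ∀ u v : E, Ω ![J u, J v] = Ω ![u, v]) {P N : Submodule ℂ E}
    (hP : ∀ v ∈ P, v ≠ 0 → 0 < Ω ![v, I • v])
    (hPmax : ∀ Q : Submodule ℂ E, (∀ v ∈ Q, v ≠ 0 → 0 < Ω ![v, I • v]) → finrank ℂ Q ≤ finrank ℂ P)
    (hN : ∀ v ∈ N, v ≠ 0 → Ω ![v, I • v] < 0)
    (hNmax : ∀ Q : Submodule ℂ E, (∀ v ∈ Q, v ≠ 0 → Ω ![v, I • v] < 0) → finrank ℂ Q ≤ finrank ℂ N) :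
    finrank ℂ P = finrank ℂ N := by
  obtain ⟨P', hP'mem, hP'd⟩ := exists_submodule_image_J hJJ hJI P
  obtain ⟨N', hN'mem, hN'd⟩ := exists_submodule_image_J hJJ hJI N
  have hP'neg : ∀ w ∈ P', w ≠ 0 → Ω ![w, I • w] < 0 := fun w hw hw0 ↦ by
    obtain ⟨v, hv, rfl⟩ := (hP'mem w).mp hw
    have hv0 : v ≠ 0 := by rintro rfl; exact hw0 (map_zero J)
    rw [apply₂_J_I_J_self_eq_neg hJI hΩJ, neg_lt_zero]
    exact hP v hv hv0
  have hN'pos : ∀ w ∈ N', w ≠ 0 → 0 < Ω ![w, I • w] := fun w hw hw0 ↦ by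
    obtain ⟨v, hv, rfl⟩ := (hN'mem w).mp hw
    have hv0 : v ≠ 0 := by rintro rfl; exact hw0 (map_zero J)
    rw [apply₂_J_I_J_self_eq_neg hJI hΩJ, neg_pos]
    exact hN v hv hv0
  have h1 := hNmax P' hP'neg
  have h2 := hPmax N' hN'pos
  omega

/-- **THE TWISTOR-LINE CRITERION FOR ONE CLASS, INTRINSIC FORM (Buskin–Izadi Thm. 5.4, existence clause, pointwise).**
Let `Ω` be an `I`-invariant real `2`-form on a complex vector space of even dimension, and let `P`, `N` be complex
subspaces of maximal dimension on which its hermitian form `h` is positive, resp. negative (`n₊ = dim P`, `n₋ = dim N`).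
Then there is a complex-structure operator `J` anticommuting with `I` and leaving `Ω` invariant — equivalently a
twistor line `S(I, J) ⊂ Compl_Ω` through `I` — if and only if `n₊ = n₋`; and if so `J` is part of a linear hyperkähler
structure `(g₀, I, J, K)` with `ad J Ω = 0` (hence `Ω` fixed by the whole `SU(2)`, §7). The even-dimension hypothesis is
`V_ℝ ≅ ℝ^{4n}` in [BI20]; the frame and its counts are produced internally (§8–§9).
[cite: BuskinIzadi2020TwistorLinesTori, Thm. 5.4 (arXiv v2 p.24 L64–74) and its proof (p.26 L26–p.27 L7)] [cite: GohbergLancasterRodman2005, §2.3 Thm. 2.3.2] [cite: Joyce2007, §10.1.1 eq. (10.1)] -/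
theorem exists_anticommuting_invariant_iff_finrank_pos_eq_finrank_neg [FiniteDimensional ℂ E] {Ω : E [⋀^Fin 2]→L[ℝ] ℝ}
    (hΩI : ∀ u v : E, Ω ![I • u, I • v] = Ω ![u, v]) (hE : Even (finrank ℂ E)) {P N : Submodule ℂ E}
    (hP : ∀ v ∈ P, v ≠ 0 → 0 < Ω ![v, I • v])
    (hPmax : ∀ Q : Submodule ℂ E, (∀ v ∈ Q, v ≠ 0 → 0 < Ω ![v, I • v]) → finrank ℂ Q ≤ finrank ℂ P)
    (hN : ∀ v ∈ N, v ≠ 0 → Ω ![v, I • v] < 0)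
    (hNmax : ∀ Q : Submodule ℂ E, (∀ v ∈ Q, v ≠ 0 → Ω ![v, I • v] < 0) → finrank ℂ Q ≤ finrank ℂ N) :
    (∃ J : E →L[ℝ] E, (∀ v, J (J v) = -v) ∧ (∀ v, J (I • v) = -(I • J v)) ∧ ∀ u v, Ω ![J u, J v] = Ω ![u, v]) ↔
      finrank ℂ P = finrank ℂ N := by
  classical
  refine ⟨fun ⟨J', hJJ, hJI, hΩJ⟩ ↦ finrank_pos_eq_finrank_neg_complex hJJ hJI hΩJ hP hPmax hN hNmax, fun hPN ↦ ?_⟩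
  obtain ⟨b, d, hb₁, hb₂⟩ := exists_orthogonal_frame hΩI
  have hpos := card_pos_eq_finrank_of_maximal hΩI b hb₁ hb₂ hP hPmax
  have hneg := card_neg_eq_finrank_of_maximal hΩI b hb₁ hb₂ hN hNmax
  have hsum := card_pos_add_card_neg_add_card_null d
  rw [Fintype.card_fin] at hsum
  have heven : Even (Fintype.card {i // d i = 0}) := by
    obtain ⟨a, ha⟩ := hE
    exact ⟨a - Fintype.card {i // 0 < d i}, by omega⟩
  obtain ⟨g₀, J', hk, hΩJ, -⟩ :=
    exists_isLinearHyperkaehler_invariant_of_card_pos_eq_card_neg hΩI b hb₁ hb₂ (by omega) heven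
  exact ⟨J', hk.J_J, hk.J_I, hΩJ⟩

/-- **… and with the hyperkähler metric**: under `n₊ = n₋` (intrinsic, as above) there is a linear hyperkähler structure
`(g₀, I, J, K)` with `Ω(J·, J·) = Ω` and `ad J Ω = 0`. [cite: BuskinIzadi2020TwistorLinesTori, Thm. 5.4 and its proof (arXiv v2 p.26 L40–p.27 L7)] [cite: Joyce2007, §10.1.1 eq. (10.1)] -/
theorem exists_isLinearHyperkaehler_invariant_of_finrank_pos_eq_finrank_neg [FiniteDimensional ℂ E]
    {Ω : E [⋀^Fin 2]→L[ℝ] ℝ}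
    (hΩI : ∀ u v : E, Ω ![I • u, I • v] = Ω ![u, v]) (hE : Even (finrank ℂ E)) {P N : Submodule ℂ E}
    (hP : ∀ v ∈ P, v ≠ 0 → 0 < Ω ![v, I • v])
    (hPmax : ∀ Q : Submodule ℂ E, (∀ v ∈ Q, v ≠ 0 → 0 < Ω ![v, I • v]) → finrank ℂ Q ≤ finrank ℂ P)
    (hN : ∀ v ∈ N, v ≠ 0 → Ω ![v, I • v] < 0)
    (hNmax : ∀ Q : Submodule ℂ E, (∀ v ∈ Q, v ≠ 0 → Ω ![v, I • v] < 0) → finrank ℂ Q ≤ finrank ℂ N)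
    (hPN : finrank ℂ P = finrank ℂ N) :
    ∃ (g₀ : E →L[ℝ] E →L[ℝ] ℝ) (J : E →L[ℝ] E), IsLinearHyperkaehler g₀ J ∧
      (∀ u v : E, Ω ![J u, J v] = Ω ![u, v]) ∧ adAlt J Ω = 0 := by
  classical
  obtain ⟨b, d, hb₁, hb₂⟩ := exists_orthogonal_frame hΩI
  have hpos := card_pos_eq_finrank_of_maximal hΩI b hb₁ hb₂ hP hPmax
  have hneg := card_neg_eq_finrank_of_maximal hΩI b hb₁ hb₂ hN hNmax
  have hsum := card_pos_add_card_neg_add_card_null d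
  rw [Fintype.card_fin] at hsum
  have heven : Even (Fintype.card {i // d i = 0}) := by
    obtain ⟨a, ha⟩ := hE
    exact ⟨a - Fintype.card {i // 0 < d i}, by omega⟩
  exact exists_isLinearHyperkaehler_invariant_of_card_pos_eq_card_neg hΩI b hb₁ hb₂ (by omega) heven


/-! ## §10 "If `n₀` is odd, there are no components of `Compl^±_Ω` containing a twistor line" (Thm. 5.4, last clause,
pointwise): an anticommuting pair `(I, J)` forces even complex dimension, `J`-invariance forces `n₊ = n₋`, and the null
space has complex dimension `n₀ = dim − n₊ − n₋` -/

/-- **Every anticommuting pair `(I, J)` of complex structures carries a linear hyperkähler metric**: average an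
`I`-hermitian metric over `J` (`g₀ = g₁ + J^*g₁`). [cite: Joyce2007, §10.1.1 eq. (10.1)] -/
theorem exists_isLinearHyperkaehler_of_anticommuting [FiniteDimensional ℂ E] (hJJ : ∀ v : E, J (J v) = -v)
    (hJI : ∀ v : E, J (I • v) = -(I • J v)) : ∃ g₀ : E →L[ℝ] E →L[ℝ] ℝ, IsLinearHyperkaehler g₀ J := by
  classical
  -- an `I`-hermitian metric `g₁` from any complex frame of even index type is not needed: take any complex basis,
  -- double the index set artificially via `E × 0`? Simpler: use the frame metric of an arbitrary basis through
  -- `Motives`-free means: the metric `Σ Re(z̄ w)` of `Module.finBasis`.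
  let b := Module.finBasis ℂ E
  let f : E → E → ℝ := fun v w ↦ ∑ k, ((b.repr v k).re * (b.repr w k).re + (b.repr v k).im * (b.repr w k).im)
  have hz_add : ∀ v w k, b.repr (v + w) k = b.repr v k + b.repr w k := fun v w k ↦ by
    rw [map_add, Finsupp.add_apply]
  have hz_smul : ∀ (r : ℝ) v k, b.repr (r • v) k = (r : ℂ) * b.repr v k := fun r v k ↦ by
    rw [← Complex.coe_smul, map_smul, Finsupp.smul_apply, smul_eq_mul]
  have hf1 : ∀ v₁ v₂ w, f (v₁ + v₂) w = f v₁ w + f v₂ w := fun v₁ v₂ w ↦ by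
    simp only [f, hz_add, Complex.add_re, Complex.add_im, ← Finset.sum_add_distrib]
    exact Finset.sum_congr rfl fun k _ ↦ by ring
  have hf2 : ∀ (r : ℝ) v w, f (r • v) w = r • f v w := fun r v w ↦ by
    simp only [f, hz_smul, Complex.re_ofReal_mul, Complex.im_ofReal_mul, smul_eq_mul, Finset.mul_sum]
    exact Finset.sum_congr rfl fun k _ ↦ by ring
  have hf3 : ∀ v w₁ w₂, f v (w₁ + w₂) = f v w₁ + f v w₂ := fun v w₁ w₂ ↦ by
    simp only [f, hz_add, Complex.add_re, Complex.add_im, ← Finset.sum_add_distrib]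
    exact Finset.sum_congr rfl fun k _ ↦ by ring
  have hf4 : ∀ (r : ℝ) v w, f v (r • w) = r • f v w := fun r v w ↦ by
    simp only [f, hz_smul, Complex.re_ofReal_mul, Complex.im_ofReal_mul, smul_eq_mul, Finset.mul_sum]
    exact Finset.sum_congr rfl fun k _ ↦ by ring
  let g₁ : E →L[ℝ] E →L[ℝ] ℝ := LinearMap.toContinuousLinearMap
    ((LinearMap.toContinuousLinearMap : (E →ₗ[ℝ] ℝ) ≃ₗ[ℝ] (E →L[ℝ] ℝ)).toLinearMap ∘ₗ LinearMap.mk₂ ℝ f hf1 hf2 hf3 hf4)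
  have hg : ∀ v w, g₁ v w = f v w := fun v w ↦ rfl
  have hsymm₁ : ∀ v w : E, g₁ v w = g₁ w v := fun v w ↦ by
    rw [hg, hg]; exact Finset.sum_congr rfl fun k _ ↦ by ring
  have hI_repr : ∀ v k, b.repr (I • v) k = I * b.repr v k := fun v k ↦ by
    rw [map_smul, Finsupp.smul_apply, smul_eq_mul]
  have hI₁ : ∀ v w : E, g₁ (I • v) (I • w) = g₁ v w := fun v w ↦ by
    rw [hg, hg]
    refine Finset.sum_congr rfl fun k _ ↦ ?_
    simp only [hI_repr, Complex.mul_re, Complex.mul_im, Complex.I_re, Complex.I_im, zero_mul, one_mul, zero_sub,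
      zero_add]
    ring
  have hnn₁ : ∀ v : E, 0 ≤ g₁ v v := fun v ↦ by
    rw [hg]
    exact Finset.sum_nonneg fun k _ ↦ by nlinarith [mul_self_nonneg (b.repr v k).re, mul_self_nonneg (b.repr v k).im]
  have hpos₁ : ∀ v : E, v ≠ 0 → 0 < g₁ v v := fun v hv ↦ by
    rw [hg]
    have hex : ∃ k, b.repr v k ≠ 0 := by
      by_contra h
      exact hv (b.repr.map_eq_zero_iff.mp (Finsupp.ext fun k ↦ not_not.mp (not_exists.mp h k)))
    obtain ⟨k₀, hk₀⟩ := hex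
    refine Finset.sum_pos' (fun k _ ↦ by nlinarith [mul_self_nonneg (b.repr v k).re, mul_self_nonneg (b.repr v k).im])
      ⟨k₀, Finset.mem_univ _, ?_⟩
    have h := Complex.normSq_pos.mpr hk₀
    rw [Complex.normSq_apply] at h
    exact h
  -- average over `J`
  let g₀ : E →L[ℝ] E →L[ℝ] ℝ := g₁ + ((g₁.comp J).flip.comp J).flip
  have hg₀ : ∀ v w, g₀ v w = g₁ v w + g₁ (J v) (J w) := fun v w ↦ rfl
  refine ⟨g₀, { symm := fun v w ↦ by rw [hg₀, hg₀, hsymm₁ v w, hsymm₁ (J v) (J w)]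
                pos := fun v hv ↦ by rw [hg₀]; exact add_pos_of_pos_of_nonneg (hpos₁ v hv) (hnn₁ _)
                inner_I := fun v w ↦ by
                  simp only [hg₀, hJI, map_neg, neg_apply, neg_neg, hI₁]
                inner_J := fun v w ↦ by
                  simp only [hg₀, hJJ, map_neg, neg_apply, neg_neg]
                  exact add_comm _ _
                J_J := hJJ
                J_I := hJI }⟩

/-- **An anticommuting pair `(I, J)` forces EVEN complex dimension** (`V_ℝ ≅ ℍ^n = ℂ^{2n}`).
[cite: Joyce2007, §10.1.1 and Def. 10.1.1] [cite: BuskinIzadi2020TwistorLinesTori, §5 (arXiv v2 p.23 L30: "n₊ + n₋ + n₀ = 2n")] -/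
theorem even_finrank_of_anticommuting [FiniteDimensional ℂ E] (hJJ : ∀ v : E, J (J v) = -v)
    (hJI : ∀ v : E, J (I • v) = -(I • J v)) : Even (finrank ℂ E) := by
  obtain ⟨g₀, hk⟩ := exists_isLinearHyperkaehler_of_anticommuting hJJ hJI
  exact hk.even_finrank

section NullSpace

variable {ι : Type*} [Fintype ι] [DecidableEq ι]

/-- **The null space in a frame**: `Ω(u, ·) = 0 ⟺ z_k(u) = 0` for every `k` with `d_k ≠ 0`; hence
`n₀ = dim_ℂ V₀ = #{k : d_k = 0}`. [cite: BuskinIzadi2020TwistorLinesTori, §5 (arXiv v2 p.23 L26–33)] -/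
theorem exists_nullSpace_finrank_eq_card {Ω : E [⋀^Fin 2]→L[ℝ] ℝ} (hΩI : ∀ u v : E, Ω ![I • u, I • v] = Ω ![u, v])
    (b : Module.Basis ι ℂ E) {d : ι → ℝ} (hb₁ : ∀ k l, Ω ![b k, I • b l] = if k = l then d k else 0)
    (hb₂ : ∀ k l, Ω ![b k, b l] = 0) :
    ∃ V₀ : Submodule ℂ E, (∀ u, u ∈ V₀ ↔ ∀ v, Ω ![u, v] = 0) ∧ finrank ℂ V₀ = Fintype.card {i // d i = 0} := by
  classical
  haveI : FiniteDimensional ℂ E := Module.Finite.of_basis b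
  let π : E →ₗ[ℂ] ({i // d i ≠ 0} → ℂ) :=
    { toFun := fun u i ↦ b.equivFun u i.1
      map_add' := fun u v ↦ by ext i; simp only [map_add, Pi.add_apply]
      map_smul' := fun c u ↦ by ext i; simp only [map_smul, Pi.smul_apply, RingHom.id_apply] }
  have hπ : ∀ u i, π u i = b.equivFun u i.1 := fun _ _ ↦ rfl
  have hsurj : Function.Surjective π := by
    intro f
    refine ⟨b.equivFun.symm (fun k ↦ if h : d k ≠ 0 then f ⟨k, h⟩ else 0), ?_⟩
    ext i
    rw [hπ, LinearEquiv.apply_symm_apply, dif_pos i.2]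
  -- `Ω(u, b_l)` and `Ω(u, I b_l)` in coordinates
  have hcoord : ∀ u l, Ω ![u, b l] = -(d l * (b.equivFun u l).im) ∧ Ω ![u, I • b l] = d l * (b.equivFun u l).re := by
    intro u l
    refine ⟨?_, ?_⟩
    · rw [apply₂_eq_sum_coord hΩI b hb₁ hb₂ u (b l), Finset.sum_eq_single l]
      · simp [Module.Basis.equivFun_self]
      · intro x _ hx
        simp [Module.Basis.equivFun_self, Ne.symm hx]
      · intro h; exact absurd (Finset.mem_univ l) h
    · rw [apply₂_eq_sum_coord hΩI b hb₁ hb₂ u (I • b l), Finset.sum_eq_single l]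
      · simp
      · intro x _ hx
        simp [Ne.symm hx]
      · intro h; exact absurd (Finset.mem_univ l) h
  refine ⟨LinearMap.ker π, fun u ↦ ⟨fun hu v ↦ ?_, fun hu ↦ ?_⟩, ?_⟩
  · -- coordinates with `d ≠ 0` vanish ⇒ `Ω(u, ·) = 0`
    have hz : ∀ k, d k ≠ 0 → b.equivFun u k = 0 := fun k hk ↦ by
      have e := congr_fun (LinearMap.mem_ker.mp hu) ⟨k, hk⟩
      rwa [hπ] at e
    rw [apply₂_eq_sum_coord hΩI b hb₁ hb₂]
    refine Finset.sum_eq_zero fun k _ ↦ ?_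
    by_cases hk : d k = 0
    · rw [hk, zero_mul]
    · rw [hz k hk, Complex.zero_re, Complex.zero_im, zero_mul, zero_mul, sub_zero, mul_zero]
  · -- `Ω(u, ·) = 0` ⇒ coordinates with `d ≠ 0` vanish
    rw [LinearMap.mem_ker]
    ext ⟨k, hk⟩
    rw [hπ, Pi.zero_apply]
    have h1 := (hcoord u k).1
    have h2 := (hcoord u k).2
    rw [hu] at h1 h2
    have him : (b.equivFun u k).im = 0 := by
      have : d k * (b.equivFun u k).im = 0 := by linarith
      exact (mul_eq_zero.mp this).resolve_left hk
    have hre : (b.equivFun u k).re = 0 := (mul_eq_zero.mp h2.symm).resolve_left hk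
    exact Complex.ext hre him
  · have h := LinearMap.finrank_range_add_finrank_ker π
    rw [LinearMap.range_eq_top.mpr hsurj, finrank_top, Module.finrank_fintype_fun_eq_card,
      Module.finrank_eq_card_basis b] at h
    have hc : Fintype.card {i // d i ≠ 0} + Fintype.card {i // d i = 0} = Fintype.card ι := by
      rw [Fintype.card_subtype_compl, Nat.sub_add_cancel (Fintype.card_subtype_le _)]
    omega

end NullSpace

/-- **"If `n₀` is odd, there are no connected components of `Compl^±_Ω` containing a twistor line" (pointwise):** if an
`I`-invariant real `2`-form `Ω` is invariant under some complex-structure operator `J` anticommuting with `I`, then its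
null space `V₀ = {u | Ω(u, ·) = 0}` has EVEN complex dimension `n₀` (`dim_ℂ E = 2n` is even, `n₊ = n₋`, and
`n₊ + n₋ + n₀ = 2n`). [cite: BuskinIzadi2020TwistorLinesTori, Thm. 5.4 (arXiv v2 p.24 L72–74) and its proof (p.26 L36–39)] -/
theorem even_finrank_nullSpace_of_anticommuting_invariant [FiniteDimensional ℂ E] (hJJ : ∀ v : E, J (J v) = -v)
    (hJI : ∀ v : E, J (I • v) = -(I • J v)) {Ω : E [⋀^Fin 2]→L[ℝ] ℝ}
    (hΩI : ∀ u v : E, Ω ![I • u, I • v] = Ω ![u, v]) (hΩJ : ∀ u v : E, Ω ![J u, J v] = Ω ![u, v])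
    {V₀ : Submodule ℂ E} (hV₀ : ∀ u, u ∈ V₀ ↔ ∀ v, Ω ![u, v] = 0) : Even (finrank ℂ V₀) := by
  classical
  obtain ⟨b, d, hb₁, hb₂⟩ := exists_orthogonal_frame hΩI
  -- `n₀ = #{d = 0}`
  obtain ⟨V₀', hV₀', hV₀'d⟩ := exists_nullSpace_finrank_eq_card hΩI b hb₁ hb₂
  have hVV : V₀ = V₀' := by
    ext u
    rw [hV₀, hV₀']
  subst hVV
  -- `#pos = #neg`: the positive span and its `J`-image
  obtain ⟨P₀, hP₀, hP₀d⟩ := exists_pos_submodule_finrank_eq_card hΩI b hb₁ hb₂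
  have hΩI' : ∀ u v : E, (-Ω) ![I • u, I • v] = (-Ω) ![u, v] := fun u v ↦ by
    simp only [ContinuousAlternatingMap.neg_apply, hΩI]
  have hb₁' : ∀ k l, (-Ω) ![b k, I • b l] = if k = l then -d k else 0 := fun k l ↦ by
    rw [ContinuousAlternatingMap.neg_apply, hb₁]; split_ifs <;> simp
  have hb₂' : ∀ k l, (-Ω) ![b k, b l] = 0 := fun k l ↦ by rw [ContinuousAlternatingMap.neg_apply, hb₂, neg_zero]
  obtain ⟨N₀, hN₀, hN₀d⟩ := exists_pos_submodule_finrank_eq_card hΩI' b hb₁' hb₂'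
  have hcardneg : Fintype.card {i // 0 < -d i} = Fintype.card {i // d i < 0} :=
    Fintype.card_congr (Equiv.subtypeEquivRight fun i ↦ by simp)
  -- `J(P₀)` is negative ⇒ `#pos ≤ #neg`; `J(N₀)` is positive ⇒ `#neg ≤ #pos`
  obtain ⟨P₁, hP₁mem, hP₁d⟩ := exists_submodule_image_J hJJ hJI P₀
  obtain ⟨N₁, hN₁mem, hN₁d⟩ := exists_submodule_image_J hJJ hJI N₀
  have hP₁neg : ∀ w ∈ P₁, w ≠ 0 → 0 < (-Ω) ![w, I • w] := fun w hw hw0 ↦ by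
    obtain ⟨v, hv, rfl⟩ := (hP₁mem w).mp hw
    have hv0 : v ≠ 0 := by rintro rfl; exact hw0 (map_zero J)
    rw [ContinuousAlternatingMap.neg_apply, apply₂_J_I_J_self_eq_neg hJI hΩJ, neg_neg]
    exact hP₀ v hv hv0
  have hN₁pos : ∀ w ∈ N₁, w ≠ 0 → 0 < Ω ![w, I • w] := fun w hw hw0 ↦ by
    obtain ⟨v, hv, rfl⟩ := (hN₁mem w).mp hw
    have hv0 : v ≠ 0 := by rintro rfl; exact hw0 (map_zero J)
    have h := hN₀ v hv hv0
    rw [ContinuousAlternatingMap.neg_apply] at h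
    rw [apply₂_J_I_J_self_eq_neg hJI hΩJ]
    exact h
  have h1 := finrank_le_card_pos hΩI' b hb₁' hb₂' hP₁neg
  have h2 := finrank_le_card_pos hΩI b hb₁ hb₂ hN₁pos
  rw [hcardneg] at h1 hN₀d
  have hsum := card_pos_add_card_neg_add_card_null d
  rw [Fintype.card_fin] at hsum
  obtain ⟨a, ha⟩ := even_finrank_of_anticommuting hJJ hJI
  exact ⟨a - Fintype.card {i // 0 < d i}, by omega⟩

end Literature.Geometry.Hyperkaehler

end
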